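import Literature.AlgebraicGeometry.Motives.HodgeThetaSubalgebraUnitaryOrthogonalChainPos
import Literature.AlgebraicGeometry.Motives.HodgeThetaSubalgebraUnitaryFortyOneFortyThreeGoodRankCores
import Literature.AlgebraicGeometry.Motives.HodgeThetaSubalgebraUnitarySquareRankOne
import Literature.AlgebraicGeometry.Motives.HodgeThetaSubalgebraUnitaryThirtyFiveFortyEightCorePart1
import Literature.AlgebraicGeometry.Motives.HodgeThetaSubalgebraUnitaryThirtyFiveFortyFourCorePart1
import Literature.AlgebraicGeometry.Motives.HodgeThetaSubalgebraUnitaryThirtyFiveThirtyEightCorePart1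
import Literature.AlgebraicGeometry.Motives.HodgeThetaSubalgebraUnitaryThirtyFiveThirtyEightCorePart2
import Literature.AlgebraicGeometry.Motives.HodgeThetaSubalgebraUnitaryThirtyFiveThirtySixCorePart1
import Literature.AlgebraicGeometry.Motives.HodgeThetaSubalgebraUnitaryThirtyFourFortyFiveCorePart1
import Literature.AlgebraicGeometry.Motives.HodgeThetaSubalgebraUnitaryThirtyTwoFiftyOneCorePart1
import Literature.AlgebraicGeometry.Motives.HodgeThetaSubalgebraUnitaryThirtyFiveFiftyFourCorePart1
import HarnessLib
import Literature.AlgebraicGeometry.Motives.HodgeThetaSubalgebraUnitaryConstantRankLeviThree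
import Literature.AlgebraicGeometry.Motives.HodgeThetaSubalgebraUnitaryEightFifteenCore
import Literature.AlgebraicGeometry.Motives.HodgeThetaSubalgebraUnitaryEightNineCore
import Literature.AlgebraicGeometry.Motives.HodgeThetaSubalgebraUnitaryEightTwentyOneCore
import Literature.AlgebraicGeometry.Motives.HodgeThetaSubalgebraUnitaryFifteenTwentyTwoCore
import Literature.AlgebraicGeometry.Motives.HodgeThetaSubalgebraUnitaryFiveCoreAll
import Literature.AlgebraicGeometry.Motives.HodgeThetaSubalgebraUnitaryFourOddCore
import Literature.AlgebraicGeometry.Motives.HodgeThetaSubalgebraUnitaryNineElevenCore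
import Literature.AlgebraicGeometry.Motives.HodgeThetaSubalgebraUnitaryNineFourteenCore
import Literature.AlgebraicGeometry.Motives.HodgeThetaSubalgebraUnitaryNineTenCore
import Literature.AlgebraicGeometry.Motives.HodgeThetaSubalgebraUnitaryNineTwentyEightCore
import Literature.AlgebraicGeometry.Motives.HodgeThetaSubalgebraUnitaryRankOneRaise
import Literature.AlgebraicGeometry.Motives.HodgeThetaSubalgebraUnitarySeventeenTwentyCore
import Literature.AlgebraicGeometry.Motives.HodgeThetaSubalgebraUnitarySixSevenCoreAll
import Literature.AlgebraicGeometry.Motives.HodgeThetaSubalgebraUnitarySixteenTwentyOneCore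
import Literature.AlgebraicGeometry.Motives.HodgeThetaSubalgebraUnitaryTenTwentySevenCore
import Literature.AlgebraicGeometry.Motives.HodgeThetaSubalgebraUnitaryThirtySevenGoodRankCores
import Literature.AlgebraicGeometry.Motives.HodgeThetaSubalgebraUnitaryThreeCoprimeCore
import Literature.AlgebraicGeometry.Motives.HodgeThetaSubalgebraUnitaryTwelveThirteenCore
import Literature.AlgebraicGeometry.Motives.HodgeThetaSubalgebraUnitaryTwelveTwentyFiveCore
import Literature.AlgebraicGeometry.Motives.HodgeThetaSubalgebraUnitaryTwoOddCore

/-!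
# (Part 2 of 4 — lemmas) The `Θ`-subalgebra theorem for unitary multiplicities `(35, 54)` — a `p = 89` cell by minimal-rank base points
# and sub-Levi recursion (Ribet 1983 Thm. 3, Lie step; abelian 89-folds of type `(35, 54)`)

Family `hodge`, layer `Literature/AlgebraicGeometry/Motives` (pure linear algebra over `ℂ`; no geometry). Research
context: cell `pub-hodge-ring2` (HONEST FRAMING: research route conditional on HC_CM; not a corollary; Q11.4-sentence-2
already refuted in dim ≥ 3), Literature lane gen 90. UNCONDITIONAL; theorems only, no definition, no named fact
(D-0026), no `sorry`.

THE PRINT. K. A. Ribet, Amer. J. Math. 105 (1983), Thm. 3 = Gordon's survey Thm. 6.3 (3) [held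
`paper:arxiv-alg-geom_9709030` p. 18]. THE METHOD: `HodgeThetaSubalgebraUnitarySixteenTwentyOneCore` (a raising operator
`B` of MINIMAL non-zero rank `m`, the profile dichotomy `i + j ≤ m` or `i, j ≥ m`, tree cores making a Levi algebra full
or killing a Levi rank, lifts `UnitaryRaisingSpace.exists_raise_finrank_range_eq` + `UnitaryLeviSetup.exists_lift`, two
pencils `UnitaryGenericRank.exists_finrank_le_and_finrank_le`, the non-vanishing lemma
`UnitaryLeviFull.exists_raise_commute_apply_ne_zero`, TOOL C `UnitaryConstantRank.exists_raise_rank_ne_two`, TOOL F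
`UnitaryConstantRank.false_of_le_rank`), the full-rank chain `UnitaryConstantRank.dvd_of_rank_eq_finrank`
(`HodgeThetaSubalgebraUnitaryNineTwentyEightCore`) and TOOL G `UnitaryOrthogonalChain.false_of_constProfile`.

THIS PART FILE holds minimal-rank lemmas of the cell (the gate caps a proposal at 200 kB); the core theorem `UnitaryThirtyFiveFiftyFour.eq_top_of_smul` is assembled in `HodgeThetaSubalgebraUnitaryThirtyFiveFiftyFourCore`.

THE CELL `(35 | 54)`. Good ranks 1, 5, 7, 11, 13 (Levi types `(1|53)`, `(5|49)`, `(7|47)`, `(11|43)`, `(13|41)` are tree cores); a proper `𝔊` has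
raising ranks in `{0, 2, 3, 4, 6, 8, 9, 10, 12, 14, 15, 16, 17, 18, 19, 20, 21, 22, 23, 24, 25, 26, 27, 28, 29, 30, 31, 32, 33, 34, 35}`; `m` minimal non-zero, `B` of rank `m`; a commuting raising `X` has profile
`(i, j)` (`i + j` a raising rank, `i + j ≤ m` or `i, j ≥ m`). SUB-LEVI RECURSION: when the non-zero profiles are constantly
`(i, j)`, the Levi algebra `L⁺` (resp. `L⁻`) is a `Θ`-algebra whose non-zero raising ranks are all `i` (resp. `j`), and the
same minimal-rank analysis applies to it (the `sub…` lemmas of §1).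
* `m = 2` (`U⁺` of type `(33 | 2)`, `U⁻` of type `(2 | 52)`): `L⁺` of type `(33 | 2)` is full and a lift with `i = 1` has `j ∈ {1}`, killed in `L⁻` (type `(2 | 52)`).
* `m = 3` (`U⁺` of type `(32 | 3)`, `U⁻` of type `(3 | 51)`): `L⁺` of type `(32 | 3)` is full and a lift with `i = 1` has `j ∈ {2}`, killed in `L⁻` (type `(3 | 51)`).
* `m = 4` (`U⁺` of type `(31 | 4)`, `U⁻` of type `(4 | 50)`): `L⁺` of type `(31 | 4)` is full and a lift with `i = 1` has `j ∈ {3}`, killed in `L⁻` (type `(4 | 50)`).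
* `m = 6` (`U⁺` of type `(29 | 6)`, `U⁻` of type `(6 | 48)`): `L⁺` of type `(29 | 6)` is full and a lift with `i = 1` has `j ∈ {5}`, killed in `L⁻` (type `(6 | 48)`).
* `m = 8` (`U⁺` of type `(27 | 8)`, `U⁻` of type `(8 | 46)`): the non-zero profiles [(0, 8), (6, 2)] are pairwise exclusive, so constant; `(6, 2)`: TOOL C on `L⁻`.
* `m = 9` (`U⁺` of type `(26 | 9)`, `U⁻` of type `(9 | 45)`): `L⁺` of type `(26 | 9)` is full and a lift with `i = 1` has `j ∈ {8}`, killed in `L⁻` (type `(9 | 45)`).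
* `m = 10` (`U⁺` of type `(25 | 10)`, `U⁻` of type `(10 | 44)`): after the Levi kills the profiles are [(0, 0), (0, 10), (10, 0), (10, 10)], so `L⁺` (type `(25 | 10)`) is a `Θ`-algebra with non-zero raising ranks in `{10}` — impossible by the sub-Levi lemmas.
* `m = 12` (`U⁺` of type `(23 | 12)`, `U⁻` of type `(12 | 42)`): after the Levi kills every profile has `i = 0` (profiles [(0, 0), (0, 12)]), against the non-vanishing lemma.
* `m = 14` (`U⁺` of type `(21 | 14)`, `U⁻` of type `(14 | 40)`): after the Levi kills the profiles are [(0, 0), (0, 14), (6, 8), (9, 5), (12, 2), (14, 0), (14, 14)], so `L⁺` (type `(21 | 14)`) is a `Θ`-algebra with non-zero raising ranks in `{6, 9, 12, 14}` — impossible by the sub-Levi lemmas.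
* `m = 15` (`U⁺` of type `(20 | 15)`, `U⁻` of type `(15 | 39)`): after the Levi kills the profiles are [(0, 0), (0, 15), (2, 13), (5, 10), (6, 9), (12, 3), (15, 0), (15, 15)], so `L⁺` (type `(20 | 15)`) is a `Θ`-algebra with non-zero raising ranks in `{2, 5, 6, 12, 15}` — impossible by the sub-Levi lemmas.
* `m = 16` (`U⁺` of type `(19 | 16)`, `U⁻` of type `(16 | 38)`): after the Levi kills every profile has `i = 0` (profiles [(0, 0), (0, 16)]), against the non-vanishing lemma.
* `m = 17` (`U⁺` of type `(18 | 17)`, `U⁻` of type `(17 | 37)`): after the Levi kills every profile has `i = 0` (profiles [(0, 0)]), against the non-vanishing lemma.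
* `m = 18` (`U⁺` of type `(17 | 18)`, `U⁻` of type `(18 | 36)`): the non-zero profiles [(0, 18), (2, 16), (3, 15), (4, 14), (6, 12), (8, 10), (9, 9), (10, 8), (12, 6), (14, 4), (15, 3), (16, 2)] are pairwise exclusive, so constant; `(2, 16)`: TOOL C on `L⁺`; `(3, 15)`: `L⁺` (type `(17 | 18)`) has constant rank `3`; `(4, 14)`: `L⁺` (type `(17 | 18)`) has constant rank `4`; `(6, 12)`: `L⁺` (type `(17 | 18)`) has constant rank `6`; `(8, 10)`: `L⁺` (type `(17 | 18)`) has constant rank `8`; `(9, 9)`: `L⁺` (type `(17 | 18)`) has constant rank `9`; `(10, 8)`: `L⁺` (type `(17 | 18)`) has constant rank `10`; `(12, 6)`: TOOL G; `(14, 4)`: TOOL G; `(15, 3)`: TOOL G; `(16, 2)`: TOOL C on `L⁻`.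
* `m = 19` (`U⁺` of type `(16 | 19)`, `U⁻` of type `(19 | 35)`): after the Levi kills every profile has `i = 0` (profiles [(0, 0), (0, 19)]), against the non-vanishing lemma.
* `m = 20` (`U⁺` of type `(15 | 20)`, `U⁻` of type `(20 | 34)`): the non-zero profiles [(0, 20), (2, 18), (4, 16), (5, 15), (6, 14), (8, 12), (10, 10), (12, 8), (14, 6)] are pairwise exclusive, so constant; `(2, 18)`: TOOL C on `L⁺`; `(4, 16)`: `L⁺` (type `(15 | 20)`) has constant rank `4`; `(5, 15)`: `L⁺` (type `(15 | 20)`) has constant rank `5`; `(6, 14)`: `L⁺` (type `(15 | 20)`) has constant rank `6`; `(8, 12)`: `L⁺` (type `(15 | 20)`) has constant rank `8`; `(10, 10)`: `L⁻` (type `(20 | 34)`) has constant rank `10`; `(12, 8)`: TOOL G; `(14, 6)`: TOOL G.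
* `m = 21` (`U⁺` of type `(14 | 21)`, `U⁻` of type `(21 | 33)`): the non-zero profiles [(0, 21), (3, 18), (6, 15), (7, 14), (9, 12), (12, 9)] are pairwise exclusive, so constant; `(3, 18)`: `L⁺` (type `(14 | 21)`) has constant rank `3`; `(6, 15)`: `L⁺` (type `(14 | 21)`) has constant rank `6`; `(7, 14)`: `L⁺` (type `(14 | 21)`) has constant rank `7`; `(9, 12)`: `L⁺` (type `(14 | 21)`) has constant rank `9`; `(12, 9)`: TOOL G.
* `m = 22` (`U⁺` of type `(13 | 22)`, `U⁻` of type `(22 | 32)`): `L⁺` of type `(13 | 22)` is full and a lift with `i = 1` has `j ∈ {21}`, killed in `L⁻` (type `(22 | 32)`).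
* `m = 23` (`U⁺` of type `(12 | 23)`, `U⁻` of type `(23 | 31)`): after the Levi kills every profile has `i = 0` (profiles [(0, 0)]), against the non-vanishing lemma.
* `m = 24` (`U⁺` of type `(11 | 24)`, `U⁻` of type `(24 | 30)`): `L⁺` of type `(11 | 24)` is full and a lift with `i = 1` has `j ∈ {23}`, killed in `L⁻` (type `(24 | 30)`).
* `m = 25` (`U⁺` of type `(10 | 25)`, `U⁻` of type `(25 | 29)`): after the Levi kills every profile has `i = 0` (profiles [(0, 0)]), against the non-vanishing lemma.
* `m = 26` (`U⁺` of type `(9 | 26)`, `U⁻` of type `(26 | 28)`): `L⁺` of type `(9 | 26)` is full and a lift with `i = 1` has `j ∈ {25}`, killed in `L⁻` (type `(26 | 28)`).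
* `m = 27` (`U⁺` of type `(8 | 27)`, `U⁻` of type `(27 | 27)`): the non-zero profiles [(0, 27), (1, 26), (2, 25), (3, 24), (4, 23), (5, 22), (6, 21), (7, 20)] are pairwise exclusive, so constant; `(1, 26)`: `L⁺` (type `(8 | 27)`) has constant rank `1`; `(2, 25)`: TOOL C on `L⁺`; `(3, 24)`: `L⁺` (type `(8 | 27)`) has constant rank `3`; `(4, 23)`: `L⁺` (type `(8 | 27)`) has constant rank `4`; `(5, 22)`: `L⁺` (type `(8 | 27)`) has constant rank `5`; `(6, 21)`: `L⁺` (type `(8 | 27)`) has constant rank `6`; `(7, 20)`: `L⁺` (type `(8 | 27)`) has constant rank `7`.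
* `m = 28` (`U⁺` of type `(7 | 28)`, `U⁻` of type `(28 | 26)`): the non-zero profiles [(2, 26), (4, 24), (6, 22)] are pairwise exclusive, so constant; `(2, 26)`: TOOL C on `L⁺`; `(4, 24)`: `L⁺` (type `(7 | 28)`) has constant rank `4`; `(6, 22)`: `L⁺` (type `(7 | 28)`) has constant rank `6`.
* `m = 29` (`U⁺` of type `(6 | 29)`, `U⁻` of type `(29 | 25)`): `L⁺` of type `(6 | 29)` is full and a lift with `i = 1` has no feasible `j`.
* `m = 30` (`U⁺` of type `(5 | 30)`, `U⁻` of type `(30 | 24)`): after the Levi kills every profile has `i = 0` (profiles [(0, 0)]), against the non-vanishing lemma.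
* `m = 31` (`U⁺` of type `(4 | 31)`, `U⁻` of type `(31 | 23)`): `L⁺` of type `(4 | 31)` is full and a lift with `i = 1` has no feasible `j`.
* `m = 32` (`U⁺` of type `(3 | 32)`, `U⁻` of type `(32 | 22)`): `L⁺` of type `(3 | 32)` is full and a lift with `i = 1` has no feasible `j`.
* `m = 33` (`U⁺` of type `(2 | 33)`, `U⁻` of type `(33 | 21)`): `L⁺` of type `(2 | 33)` is full and a lift with `i = 1` has no feasible `j`.
* `m = 34` (`U⁺` of type `(1 | 34)`, `U⁻` of type `(34 | 20)`): `L⁺` of type `(1 | 34)` is full and a lift with `i = 1` has no feasible `j`.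
* `m = 35 = dim P`: the full-rank chain would give `35 ∣ 54`.

## References
* [Ribet1983] K. A. Ribet, *Hodge classes on certain types of abelian varieties*, Amer. J. Math. 105 (1983), Thm. 3.
* [Gordon1997] B. B. Gordon, *A survey of the Hodge conjecture for abelian varieties*, Thm. 6.3 (3), pp. 18–19.
* [Deligne1982HodgeCycles] P. Deligne, *Hodge cycles on abelian varieties*, LNM 900 (1982), I §3 Prop. 3.4, 3.6.
* [GoodmanWallachGTM255] R. Goodman, N. R. Wallach, GTM 255 (2009), §2.3.1, §4.1.1.
* [HoffmanKunze1971LinearAlgebra] K. Hoffman, R. Kunze, *Linear Algebra* (1971), §3.1 Thm. 2, §6.7, §8.5.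
-/

noncomputable section

open Module

namespace Literature.AlgebraicGeometry.Motives

namespace HodgeStructure

universe u

variable {W : Type u} [AddCommGroup W] [Module ℂ W]

/-! ### §2 The minimal-rank lemmas -/

/-- `(35 | 54)`, minimal rank `12`: after the Levi kills every profile has `i = 0` (profiles [(0, 0), (0, 12)]), against the non-vanishing lemma. [cite: Ribet1983, Thm. 3] [cite: Gordon1997, Thm. 6.3 (3)]
[cite: Deligne1982HodgeCycles, I §3 Prop. 3.4, 3.6] [cite: GoodmanWallachGTM255, §4.1.1] -/
theorem UnitaryThirtyFiveFiftyFour.no_minRank_12 [FiniteDimensional ℂ W] {𝔊 : Submodule ℂ (Module.End ℂ W)}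
    (hbr : ∀ Y ∈ 𝔊, ∀ Z ∈ 𝔊, Y * Z - Z * Y ∈ 𝔊)
    (hirr : ∀ U : Submodule ℂ W, (∀ A ∈ 𝔊, ∀ u ∈ U, A u ∈ U) → U = ⊥ ∨ U = ⊤)
    {Θ : Module.End ℂ W} (hΘ : Θ ∈ 𝔊) (hΘΘ : Θ * Θ = 1)
    {P Q : Submodule ℂ W} (hP : ∀ x, x ∈ P ↔ Θ x = x) (hQ : ∀ x, x ∈ Q ↔ Θ x = -x)
    (hP35 : Module.finrank ℂ P = 35) (hQ54 : Module.finrank ℂ Q = 54)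
    {s : W → W → ℂ} (hadd : ∀ x y z, s (x + y) z = s x z + s y z)
    (hsmul : ∀ (c : ℂ) (x y : W), s (c • x) y = c * s x y) (hsymm : ∀ x y, s y x = starRingEnd ℂ (s x y))
    (hPQ : ∀ p ∈ P, ∀ q ∈ Q, s p q = 0) (hdefP : ∀ p ∈ P, s p p = 0 → p = 0) (hdefQ : ∀ q ∈ Q, s q q = 0 → q = 0)
    (hadj : ∀ X ∈ 𝔊, ∃ Y ∈ 𝔊, ∀ x y, s (X x) y = s x (Y y))
    (hS : ∀ B' ∈ 𝔊, Θ * B' = B' → B' * Θ = -B' →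
      Module.finrank ℂ (LinearMap.range B') = 0 ∨ Module.finrank ℂ (LinearMap.range B') = 12 ∨ Module.finrank ℂ (LinearMap.range B') = 14 ∨ Module.finrank ℂ (LinearMap.range B') = 15 ∨ Module.finrank ℂ (LinearMap.range B') = 16 ∨ Module.finrank ℂ (LinearMap.range B') = 17 ∨ Module.finrank ℂ (LinearMap.range B') = 18 ∨ Module.finrank ℂ (LinearMap.range B') = 19 ∨ Module.finrank ℂ (LinearMap.range B') = 20 ∨ Module.finrank ℂ (LinearMap.range B') = 21 ∨ Module.finrank ℂ (LinearMap.range B') = 22 ∨ Module.finrank ℂ (LinearMap.range B') = 23 ∨ Module.finrank ℂ (LinearMap.range B') = 24 ∨ Module.finrank ℂ (LinearMap.range B') = 25 ∨ Module.finrank ℂ (LinearMap.range B') = 26 ∨ Module.finrank ℂ (LinearMap.range B') = 27 ∨ Module.finrank ℂ (LinearMap.range B') = 28 ∨ Module.finrank ℂ (LinearMap.range B') = 29 ∨ Module.finrank ℂ (LinearMap.range B') = 30 ∨ Module.finrank ℂ (LinearMap.range B') = 31 ∨ Module.finrank ℂ (LinearMap.range B') = 32 ∨ Module.finrank ℂ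 (LinearMap.range B') = 33 ∨ Module.finrank ℂ (LinearMap.range B') = 34 ∨ Module.finrank ℂ (LinearMap.range B') = 35)
    {B : Module.End ℂ W} (hB : B ∈ 𝔊) (hΘB : Θ * B = B) (hBΘ : B * Θ = -B)
    (hr : Module.finrank ℂ (LinearMap.range B) = 12) : False := by
  classical
  have hsU : ∀ U : Submodule ℂ W, ∀ x y z : U, s ((x + y : U) : W) z = s (x : W) z + s (y : W) z :=
    fun U x y z => by simp only [Submodule.coe_add, hadd]
  have hsmU : ∀ U : Submodule ℂ W, ∀ (c : ℂ) (x y : U), s ((c • x : U) : W) y = c * s (x : W) y :=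
    fun U c x y => by simp only [Submodule.coe_smul, hsmul]
  have hno1 : ∀ B' ∈ 𝔊, Θ * B' = B' → B' * Θ = -B' → Module.finrank ℂ (LinearMap.range B') ≠ 1 := by
    intro B' hB' hΘB' hB'Θ h1
    rcases hS B' hB' hΘB' hB'Θ with h | h | h | h | h | h | h | h | h | h | h | h | h | h | h | h | h | h | h | h | h | h | h | h <;> omega
  have hmin : ∀ Y ∈ 𝔊, Θ * Y = Y → Y * Θ = -Y → Y ≠ 0 → 12 ≤ Module.finrank ℂ (LinearMap.range Y) := by
    intro Y hY hΘY hYΘ hY0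
    have h0 : Module.finrank ℂ (LinearMap.range Y) ≠ 0 := fun h =>
      hY0 (LinearMap.range_eq_bot.1 (Submodule.finrank_eq_zero.1 h))
    rcases hS Y hY hΘY hYΘ with h | h | h | h | h | h | h | h | h | h | h | h | h | h | h | h | h | h | h | h | h | h | h | h <;> omega
  have hmin' : ∀ Z ∈ 𝔊, Θ * Z = Z → Z * Θ = -Z → Z ≠ 0 → Module.finrank ℂ (LinearMap.range B) ≤ Module.finrank ℂ (LinearMap.range Z) := by
    rw [hr]; exact hmin
  obtain ⟨ι, Um, Up, PU, QU, Lm, ιm, Pm, Qm, Lp, ιp, Pp, Qp, hιmem, hιι, hιΘ, hιs, hUm, hUp, hfinUm, hfinUp,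
    hPM, hQM, hPU, hQU, hrangeP, hPUP, hQUQ, hfinQM, hfinPU, hfinQU, hLm, hLp,
    hιmapply, hPmmem, hQmmem, hbrLm, hirrLm, hιmmem, hιmιm, hPm, hQm, hfinPm, hfinQm, hPmQm, hdefPm, hdefQm, hadjLm,
    hιpapply, hPpmem, hQpmem, hbrLp, hirrLp, hιpmem, hιpιp, hPp, hQp, hfinPp, hfinQp, hPpQp, hdefPp, hdefQp, hadjLp,
    hsplit⟩ :=
    UnitaryLeviSetup.exists_levi_pair hbr hirr hΘ hΘΘ hP hQ hadd hsymm hPQ hdefP hdefQ hadj hB hΘB hBΘ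
  have hdich : ∀ X ∈ 𝔊, Θ * X = X → X * Θ = -X → X * ι = ι * X →
      Module.finrank ℂ (Up.map X) + Module.finrank ℂ (Um.map X) ≤ Module.finrank ℂ (LinearMap.range B) ∨
        (12 ≤ Module.finrank ℂ (Up.map X) ∧ 12 ≤ Module.finrank ℂ (Um.map X)) := fun X hX hΘX hXΘ hXc =>
    UnitaryLeviSetup.profile_dichotomy hbr hΘΘ hP hQ hadd hsymm hPQ hdefP hdefQ hadj hmin hB hΘB hBΘ hιι hιΘ hιs hUm hUp
      hPM hQM hQU hfinQU hrangeP hX hΘX hXΘ hXc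
  have hfinQU' := hfinQU
  rw [hr] at hfinQM hfinPU hfinQU hfinPm hfinQm hfinPp hfinQp hsplit hdich
  rw [hQ54] at hfinQM hfinQm hfinUm
  rw [hP35] at hfinPU hfinPp hfinUp
  have hcm : ∀ Z : Module.End ℂ W, Z * ι = ι * Z → ∀ x ∈ Um, Z x ∈ Um := fun Z hZ x hx =>
    (hUm _).2 (by rw [← Module.End.mul_apply, ← hZ, Module.End.mul_apply, (hUm x).1 hx, map_neg])
  have hcp : ∀ Z : Module.End ℂ W, Z * ι = ι * Z → ∀ x ∈ Up, Z x ∈ Up := fun Z hZ x hx =>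
    (hUp _).2 (by rw [← Module.End.mul_apply, ← hZ, Module.End.mul_apply, (hUp x).1 hx])
  have hfullm_of : Lm = ⊤ → False := fun h =>
    UnitaryLeviSetup.false_of_full_larger hbr hΘΘ hno1 hιι hιΘ hUm hUp (by omega) (by omega) hPM hQM (by omega)
      (by omega) hLm h
  have hkillm1 : ∀ X ∈ 𝔊, Θ * X = X → X * Θ = -X → X * ι = ι * X → Module.finrank ℂ (Um.map X) ≠ 1 := by
    intro X hX hΘX hXΘ hXc h1
    obtain ⟨hxmem, hιmx, hxιm, hxrk⟩ := UnitaryLeviSetup.restrict_mem hcm hLm hιmapply X hX hΘX hXΘ hXc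
    rw [h1] at hxrk
    exact hfullm_of (UnitaryRankOneRaise.eq_top_of_rankOne_raise hbrLm hirrLm hιmmem hιmιm hPm hQm
      (s := fun v w : Um => s (v : W) w) (hsU Um) (fun v w => hsymm v w) hPmQm hdefPm hdefQm hadjLm hxmem hιmx hxιm
      hxrk (by omega) (by omega) (by omega))
  have hkillm5 : ∀ X ∈ 𝔊, Θ * X = X → X * Θ = -X → X * ι = ι * X → Module.finrank ℂ (Um.map X) ≠ 5 := by
    intro X hX hΘX hXΘ hXc h5
    obtain ⟨hxmem, hιmx, hxιm, hxrk⟩ := UnitaryLeviSetup.restrict_mem hcm hLm hιmapply X hX hΘX hXΘ hXc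
    rw [h5] at hxrk
    refine hfullm_of (UnitaryDoubleLevi.eq_top_of_raise_of_core hbrLm hirrLm hιmmem hιmιm hPm hQm
      (s := fun v w : Um => s (v : W) w) (hsU Um) (fun v w => hsymm v w) hPmQm hdefPm hdefQm hadjLm hxmem hιmx hxιm
      (by rw [hxrk]; omega) (by omega) (by omega)
      fun U' 𝔩' ι' P' Q' hbr𝔩' hirr𝔩' hι' hι'ι' hP' hQ' hfinP' hfinQ' hP'Q' hdefP' hdefQ' hadj𝔩' => ?_)
    rw [hxrk] at hfinP' hfinQ'
    exact UnitaryFive.eq_top_of_smul hbr𝔩' hirr𝔩' hι' hι'ι' hP' hQ' hfinP' (by omega) (s := fun x y : U' => s ((x : Um) : W) y) (fun x y z => by simp only [Submodule.coe_add, hadd]) (fun c x y => by simp only [Submodule.coe_smul, hsmul]) (fun x y => hsymm _ _) hP'Q' hdefP' hdefQ' hadj𝔩'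
  have hkillm11 : ∀ X ∈ 𝔊, Θ * X = X → X * Θ = -X → X * ι = ι * X → Module.finrank ℂ (Um.map X) ≠ 11 := by
    intro X hX hΘX hXΘ hXc h11
    obtain ⟨hxmem, hιmx, hxιm, hxrk⟩ := UnitaryLeviSetup.restrict_mem hcm hLm hιmapply X hX hΘX hXΘ hXc
    rw [h11] at hxrk
    refine hfullm_of (UnitaryDoubleLevi.eq_top_of_raise_of_core hbrLm hirrLm hιmmem hιmιm hPm hQm
      (s := fun v w : Um => s (v : W) w) (hsU Um) (fun v w => hsymm v w) hPmQm hdefPm hdefQm hadjLm hxmem hιmx hxιm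
      (by rw [hxrk]; omega) (by omega) (by omega)
      fun U' 𝔩' ι' P' Q' hbr𝔩' hirr𝔩' hι' hι'ι' hP' hQ' hfinP' hfinQ' hP'Q' hdefP' hdefQ' hadj𝔩' => ?_)
    rw [hxrk] at hfinP' hfinQ'
    exact UnitaryEleven.eq_top_of_smul hbr𝔩' hirr𝔩' hι' hι'ι' hP' hQ' hfinP' (by omega) (s := fun x y : U' => s ((x : Um) : W) y) (fun x y z => by simp only [Submodule.coe_add, hadd]) (fun c x y => by simp only [Submodule.coe_smul, hsmul]) (fun x y => hsymm _ _) hP'Q' hdefP' hdefQ' hadj𝔩'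
  have hfullp_of : Lp = ⊤ → False := by
    intro hLptop
    obtain ⟨T1, hιT1, hT1ι, hT1r⟩ := UnitaryRaisingSpace.exists_raise_finrank_range_eq hιpιp hPp hQp (k := 1)
      (by omega) (by omega)
    obtain ⟨X1, hX1, hΘX1, hX1Θ, hX1c, hX1Up⟩ := UnitaryLeviSetup.exists_lift hbr hΘ hΘΘ hcp hιΘ hLp hιpapply T1
      (by rw [hLptop]; exact Submodule.mem_top) hιT1 hT1ι
    rw [hT1r] at hX1Up
    obtain ⟨hs1, hi1, hi1', hj1, hj1'⟩ := hsplit X1 hΘX1 hX1Θ hX1c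
    have hrk1 := hS X1 hX1 hΘX1 hX1Θ
    have hd1 := hdich X1 hX1 hΘX1 hX1Θ hX1c
    rw [hs1] at hrk1
    rw [hX1Up] at hrk1 hd1
    have hk_hkillm11 := hkillm11 X1 hX1 hΘX1 hX1Θ hX1c
    omega
  have hkillp2 : ∀ X ∈ 𝔊, Θ * X = X → X * Θ = -X → X * ι = ι * X → Module.finrank ℂ (Up.map X) ≠ 2 := by
    intro X hX hΘX hXΘ hXc h2
    obtain ⟨hymem, hιpy, hyιp, hyrk⟩ := UnitaryLeviSetup.restrict_mem hcp hLp hιpapply X hX hΘX hXΘ hXc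
    rw [h2] at hyrk
    refine hfullp_of (UnitaryDoubleLevi.eq_top_of_raise_of_core' hbrLp hirrLp hιpmem hιpιp hPp hQp
      (s := fun v w : Up => s (v : W) w) (hsU Up) (fun v w => hsymm v w) hPpQp hdefPp hdefQp hadjLp hymem hιpy hyιp
      (by rw [hyrk]; omega) (by omega) (by omega)
      fun U' 𝔩' ι' P' Q' hbr𝔩' hirr𝔩' hι' hι'ι' hP' hQ' hfinP' hfinQ' hP'Q' hdefP' hdefQ' hadj𝔩' => ?_)
    rw [hyrk] at hfinP' hfinQ'
    exact UnitaryTwoOdd.eq_top hbr𝔩' hirr𝔩' hι' hι'ι' hP' hQ' hfinP' ⟨10, by omega⟩ (s := fun x y : U' => s ((x : Up) : W) y) (fun x y z => by simp only [Submodule.coe_add, hadd]) (fun x y => hsymm _ _) hP'Q' hdefP' hdefQ' hadj𝔩'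
  have hkillp3 : ∀ X ∈ 𝔊, Θ * X = X → X * Θ = -X → X * ι = ι * X → Module.finrank ℂ (Up.map X) ≠ 3 := by
    intro X hX hΘX hXΘ hXc h3
    obtain ⟨hymem, hιpy, hyιp, hyrk⟩ := UnitaryLeviSetup.restrict_mem hcp hLp hιpapply X hX hΘX hXΘ hXc
    rw [h3] at hyrk
    refine hfullp_of (UnitaryDoubleLevi.eq_top_of_raise_of_core' hbrLp hirrLp hιpmem hιpιp hPp hQp
      (s := fun v w : Up => s (v : W) w) (hsU Up) (fun v w => hsymm v w) hPpQp hdefPp hdefQp hadjLp hymem hιpy hyιp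
      (by rw [hyrk]; omega) (by omega) (by omega)
      fun U' 𝔩' ι' P' Q' hbr𝔩' hirr𝔩' hι' hι'ι' hP' hQ' hfinP' hfinQ' hP'Q' hdefP' hdefQ' hadj𝔩' => ?_)
    rw [hyrk] at hfinP' hfinQ'
    exact UnitaryThreeCoprime.eq_top hbr𝔩' hirr𝔩' hι' hι'ι' hP' hQ' hfinP' (by omega) (s := fun x y : U' => s ((x : Up) : W) y) (fun x y z => by simp only [Submodule.coe_add, hadd]) (fun x y => hsymm _ _) hP'Q' hdefP' hdefQ' hadj𝔩'
  have hkillp4 : ∀ X ∈ 𝔊, Θ * X = X → X * Θ = -X → X * ι = ι * X → Module.finrank ℂ (Up.map X) ≠ 4 := by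
    intro X hX hΘX hXΘ hXc h4
    obtain ⟨hymem, hιpy, hyιp, hyrk⟩ := UnitaryLeviSetup.restrict_mem hcp hLp hιpapply X hX hΘX hXΘ hXc
    rw [h4] at hyrk
    refine hfullp_of (UnitaryDoubleLevi.eq_top_of_raise_of_core' hbrLp hirrLp hιpmem hιpιp hPp hQp
      (s := fun v w : Up => s (v : W) w) (hsU Up) (fun v w => hsymm v w) hPpQp hdefPp hdefQp hadjLp hymem hιpy hyιp
      (by rw [hyrk]; omega) (by omega) (by omega)
      fun U' 𝔩' ι' P' Q' hbr𝔩' hirr𝔩' hι' hι'ι' hP' hQ' hfinP' hfinQ' hP'Q' hdefP' hdefQ' hadj𝔩' => ?_)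
    rw [hyrk] at hfinP' hfinQ'
    exact UnitaryFourOdd.eq_top hbr𝔩' hirr𝔩' hι' hι'ι' hP' hQ' hfinP' ⟨9, by omega⟩ (s := fun x y : U' => s ((x : Up) : W) y) (fun x y z => by simp only [Submodule.coe_add, hadd]) (fun x y => hsymm _ _) hP'Q' hdefP' hdefQ' hadj𝔩'
  have hkillp5 : ∀ X ∈ 𝔊, Θ * X = X → X * Θ = -X → X * ι = ι * X → Module.finrank ℂ (Up.map X) ≠ 5 := by
    intro X hX hΘX hXΘ hXc h5
    obtain ⟨hymem, hιpy, hyιp, hyrk⟩ := UnitaryLeviSetup.restrict_mem hcp hLp hιpapply X hX hΘX hXΘ hXc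
    rw [h5] at hyrk
    refine hfullp_of (UnitaryDoubleLevi.eq_top_of_raise_of_core' hbrLp hirrLp hιpmem hιpιp hPp hQp
      (s := fun v w : Up => s (v : W) w) (hsU Up) (fun v w => hsymm v w) hPpQp hdefPp hdefQp hadjLp hymem hιpy hyιp
      (by rw [hyrk]; omega) (by omega) (by omega)
      fun U' 𝔩' ι' P' Q' hbr𝔩' hirr𝔩' hι' hι'ι' hP' hQ' hfinP' hfinQ' hP'Q' hdefP' hdefQ' hadj𝔩' => ?_)
    rw [hyrk] at hfinP' hfinQ'
    exact UnitaryFive.eq_top_of_smul hbr𝔩' hirr𝔩' hι' hι'ι' hP' hQ' hfinP' (by omega) (s := fun x y : U' => s ((x : Up) : W) y) (fun x y z => by simp only [Submodule.coe_add, hadd]) (fun c x y => by simp only [Submodule.coe_smul, hsmul]) (fun x y => hsymm _ _) hP'Q' hdefP' hdefQ' hadj𝔩'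
  have hkillp6 : ∀ X ∈ 𝔊, Θ * X = X → X * Θ = -X → X * ι = ι * X → Module.finrank ℂ (Up.map X) ≠ 6 := by
    intro X hX hΘX hXΘ hXc h6
    obtain ⟨hymem, hιpy, hyιp, hyrk⟩ := UnitaryLeviSetup.restrict_mem hcp hLp hιpapply X hX hΘX hXΘ hXc
    rw [h6] at hyrk
    refine hfullp_of (UnitaryDoubleLevi.eq_top_of_raise_of_core' hbrLp hirrLp hιpmem hιpιp hPp hQp
      (s := fun v w : Up => s (v : W) w) (hsU Up) (fun v w => hsymm v w) hPpQp hdefPp hdefQp hadjLp hymem hιpy hyιp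
      (by rw [hyrk]; omega) (by omega) (by omega)
      fun U' 𝔩' ι' P' Q' hbr𝔩' hirr𝔩' hι' hι'ι' hP' hQ' hfinP' hfinQ' hP'Q' hdefP' hdefQ' hadj𝔩' => ?_)
    rw [hyrk] at hfinP' hfinQ'
    exact UnitarySix.eq_top_of_smul hbr𝔩' hirr𝔩' hι' hι'ι' hP' hQ' hfinP' ⟨8, by omega⟩ (by omega) (s := fun x y : U' => s ((x : Up) : W) y) (fun x y z => by simp only [Submodule.coe_add, hadd]) (fun c x y => by simp only [Submodule.coe_smul, hsmul]) (fun x y => hsymm _ _) hP'Q' hdefP' hdefQ' hadj𝔩'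
  have hkillp8 : ∀ X ∈ 𝔊, Θ * X = X → X * Θ = -X → X * ι = ι * X → Module.finrank ℂ (Up.map X) ≠ 8 := by
    intro X hX hΘX hXΘ hXc h8
    obtain ⟨hymem, hιpy, hyιp, hyrk⟩ := UnitaryLeviSetup.restrict_mem hcp hLp hιpapply X hX hΘX hXΘ hXc
    rw [h8] at hyrk
    refine hfullp_of (UnitaryDoubleLevi.eq_top_of_raise_of_core' hbrLp hirrLp hιpmem hιpιp hPp hQp
      (s := fun v w : Up => s (v : W) w) (hsU Up) (fun v w => hsymm v w) hPpQp hdefPp hdefQp hadjLp hymem hιpy hyιp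
      (by rw [hyrk]; omega) (by omega) (by omega)
      fun U' 𝔩' ι' P' Q' hbr𝔩' hirr𝔩' hι' hι'ι' hP' hQ' hfinP' hfinQ' hP'Q' hdefP' hdefQ' hadj𝔩' => ?_)
    rw [hyrk] at hfinP' hfinQ'
    exact UnitaryEightFifteen.eq_top_of_smul hbr𝔩' hirr𝔩' hι' hι'ι' hP' hQ' hfinP' (by omega) (s := fun x y : U' => s ((x : Up) : W) y) (fun x y z => by simp only [Submodule.coe_add, hadd]) (fun c x y => by simp only [Submodule.coe_smul, hsmul]) (fun x y => hsymm _ _) hP'Q' hdefP' hdefQ' hadj𝔩'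
  have hkillp9 : ∀ X ∈ 𝔊, Θ * X = X → X * Θ = -X → X * ι = ι * X → Module.finrank ℂ (Up.map X) ≠ 9 := by
    intro X hX hΘX hXΘ hXc h9
    obtain ⟨hymem, hιpy, hyιp, hyrk⟩ := UnitaryLeviSetup.restrict_mem hcp hLp hιpapply X hX hΘX hXΘ hXc
    rw [h9] at hyrk
    refine hfullp_of (UnitaryDoubleLevi.eq_top_of_raise_of_core' hbrLp hirrLp hιpmem hιpιp hPp hQp
      (s := fun v w : Up => s (v : W) w) (hsU Up) (fun v w => hsymm v w) hPpQp hdefPp hdefQp hadjLp hymem hιpy hyιp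
      (by rw [hyrk]; omega) (by omega) (by omega)
      fun U' 𝔩' ι' P' Q' hbr𝔩' hirr𝔩' hι' hι'ι' hP' hQ' hfinP' hfinQ' hP'Q' hdefP' hdefQ' hadj𝔩' => ?_)
    rw [hyrk] at hfinP' hfinQ'
    exact UnitaryNineFourteen.eq_top_of_smul hbr𝔩' hirr𝔩' hι' hι'ι' hP' hQ' hfinP' (by omega) (s := fun x y : U' => s ((x : Up) : W) y) (fun x y z => by simp only [Submodule.coe_add, hadd]) (fun c x y => by simp only [Submodule.coe_smul, hsmul]) (fun x y => hsymm _ _) hP'Q' hdefP' hdefQ' hadj𝔩'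
  have hkillp10 : ∀ X ∈ 𝔊, Θ * X = X → X * Θ = -X → X * ι = ι * X → Module.finrank ℂ (Up.map X) ≠ 10 := by
    intro X hX hΘX hXΘ hXc h10
    obtain ⟨hymem, hιpy, hyιp, hyrk⟩ := UnitaryLeviSetup.restrict_mem hcp hLp hιpapply X hX hΘX hXΘ hXc
    rw [h10] at hyrk
    refine hfullp_of (UnitaryDoubleLevi.eq_top_of_raise_of_core' hbrLp hirrLp hιpmem hιpιp hPp hQp
      (s := fun v w : Up => s (v : W) w) (hsU Up) (fun v w => hsymm v w) hPpQp hdefPp hdefQp hadjLp hymem hιpy hyιp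
      (by rw [hyrk]; omega) (by omega) (by omega)
      fun U' 𝔩' ι' P' Q' hbr𝔩' hirr𝔩' hι' hι'ι' hP' hQ' hfinP' hfinQ' hP'Q' hdefP' hdefQ' hadj𝔩' => ?_)
    rw [hyrk] at hfinP' hfinQ'
    exact UnitaryThirteen.eq_top_of_smul' hbr𝔩' hirr𝔩' hι' hι'ι' hP' hQ' (by omega) (by omega) (s := fun x y : U' => s ((x : Up) : W) y) (fun x y z => by simp only [Submodule.coe_add, hadd]) (fun c x y => by simp only [Submodule.coe_smul, hsmul]) (fun x y => hsymm _ _) hP'Q' hdefP' hdefQ' hadj𝔩'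
  have hkillp12 : ∀ X ∈ 𝔊, Θ * X = X → X * Θ = -X → X * ι = ι * X → Module.finrank ℂ (Up.map X) ≠ 12 := by
    intro X hX hΘX hXΘ hXc h12
    obtain ⟨hymem, hιpy, hyιp, hyrk⟩ := UnitaryLeviSetup.restrict_mem hcp hLp hιpapply X hX hΘX hXΘ hXc
    rw [h12] at hyrk
    refine hfullp_of (UnitaryDoubleLevi.eq_top_of_raise_of_core' hbrLp hirrLp hιpmem hιpιp hPp hQp
      (s := fun v w : Up => s (v : W) w) (hsU Up) (fun v w => hsymm v w) hPpQp hdefPp hdefQp hadjLp hymem hιpy hyιp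
      (by rw [hyrk]; omega) (by omega) (by omega)
      fun U' 𝔩' ι' P' Q' hbr𝔩' hirr𝔩' hι' hι'ι' hP' hQ' hfinP' hfinQ' hP'Q' hdefP' hdefQ' hadj𝔩' => ?_)
    rw [hyrk] at hfinP' hfinQ'
    exact UnitaryEleven.eq_top_of_smul' hbr𝔩' hirr𝔩' hι' hι'ι' hP' hQ' (by omega) (by omega) (s := fun x y : U' => s ((x : Up) : W) y) (fun x y z => by simp only [Submodule.coe_add, hadd]) (fun c x y => by simp only [Submodule.coe_smul, hsmul]) (fun x y => hsymm _ _) hP'Q' hdefP' hdefQ' hadj𝔩'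
  have hprof : ∀ X ∈ 𝔊, Θ * X = X → X * Θ = -X → X * ι = ι * X →
      (Module.finrank ℂ (Up.map X) = 0 ∧ Module.finrank ℂ (Um.map X) = 0) ∨
        (Module.finrank ℂ (Up.map X) = 0 ∧ Module.finrank ℂ (Um.map X) = 12) := by
    intro X hX hΘX hXΘ hXc
    obtain ⟨hs, hi, hi', hj, hj'⟩ := hsplit X hΘX hXΘ hXc
    have hkillm1' := hkillm1 X hX hΘX hXΘ hXc
    have hkillm5' := hkillm5 X hX hΘX hXΘ hXc
    have hkillm11' := hkillm11 X hX hΘX hXΘ hXc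
    have hkillp2' := hkillp2 X hX hΘX hXΘ hXc
    have hkillp3' := hkillp3 X hX hΘX hXΘ hXc
    have hkillp4' := hkillp4 X hX hΘX hXΘ hXc
    have hkillp5' := hkillp5 X hX hΘX hXΘ hXc
    have hkillp6' := hkillp6 X hX hΘX hXΘ hXc
    have hkillp8' := hkillp8 X hX hΘX hXΘ hXc
    have hkillp9' := hkillp9 X hX hΘX hXΘ hXc
    have hkillp10' := hkillp10 X hX hΘX hXΘ hXc
    have hkillp12' := hkillp12 X hX hΘX hXΘ hXc
    have hrk := hS X hX hΘX hXΘ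
    have hd := hdich X hX hΘX hXΘ hXc
    rw [hs] at hrk
    generalize Module.finrank ℂ ↥(Submodule.map X Um) = jj at *
    have hjle : jj ≤ 12 := by omega
    interval_cases jj
    · exact Or.inl ⟨by omega, rfl⟩
    · exact (hkillm1' rfl).elim
    · exfalso; omega
    · exfalso; omega
    · exfalso; omega
    · exact (hkillm5' rfl).elim
    · exfalso; omega
    · exfalso; omega
    · exfalso; omega
    · exfalso; omega
    · exfalso; omega
    · exact (hkillm11' rfl).elim
    · exact Or.inr (⟨by omega, rfl⟩)
  obtain ⟨⟨p, hp⟩, hp0⟩ := Module.finrank_pos_iff_exists_ne_zero.1 (show 0 < Module.finrank ℂ PU by omega)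
  obtain ⟨⟨q, hq⟩, hq0⟩ := Module.finrank_pos_iff_exists_ne_zero.1 (show 0 < Module.finrank ℂ QU by omega)
  obtain ⟨X₀, hX₀, hΘX₀, hX₀Θ, hX₀c, c₀, hιc₀, -, hX₀c0⟩ :=
    UnitaryLeviFull.exists_raise_commute_apply_ne_zero hbr hirr hΘ hΘΘ hQ hιmem hιι hιΘ hUm hUp
      ⟨p, fun h => hp0 (Subtype.ext h), ((hPU p).1 hp).1, ((hPU p).1 hp).2⟩
      ⟨q, fun h => hq0 (Subtype.ext h), ((hQU q).1 hq).1, ((hQU q).1 hq).2⟩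
  have hX₀i : Module.finrank ℂ (Up.map X₀) ≠ 0 := fun h0 => by
    have hmem : X₀ c₀ ∈ Up.map X₀ := Submodule.mem_map_of_mem ((hUp c₀).2 hιc₀)
    rw [Submodule.finrank_eq_zero.1 h0, Submodule.mem_bot] at hmem
    exact hX₀c0 hmem
  have hp0 := hprof X₀ hX₀ hΘX₀ hX₀Θ hX₀c
  omega

/-- `(35 | 54)`, minimal rank `14`: after the Levi kills the profiles are [(0, 0), (0, 14), (6, 8), (9, 5), (12, 2), (14, 0), (14, 14)], so `L⁺` (type `(21 | 14)`) is a `Θ`-algebra with non-zero raising ranks in `{6, 9, 12, 14}` — impossible by the sub-Levi lemmas. [cite: Ribet1983, Thm. 3] [cite: Gordon1997, Thm. 6.3 (3)]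
[cite: Deligne1982HodgeCycles, I §3 Prop. 3.4, 3.6] [cite: GoodmanWallachGTM255, §4.1.1] -/
theorem UnitaryThirtyFiveFiftyFour.no_minRank_14 [FiniteDimensional ℂ W] {𝔊 : Submodule ℂ (Module.End ℂ W)}
    (hbr : ∀ Y ∈ 𝔊, ∀ Z ∈ 𝔊, Y * Z - Z * Y ∈ 𝔊)
    (hirr : ∀ U : Submodule ℂ W, (∀ A ∈ 𝔊, ∀ u ∈ U, A u ∈ U) → U = ⊥ ∨ U = ⊤)
    {Θ : Module.End ℂ W} (hΘ : Θ ∈ 𝔊) (hΘΘ : Θ * Θ = 1)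
    {P Q : Submodule ℂ W} (hP : ∀ x, x ∈ P ↔ Θ x = x) (hQ : ∀ x, x ∈ Q ↔ Θ x = -x)
    (hP35 : Module.finrank ℂ P = 35) (hQ54 : Module.finrank ℂ Q = 54)
    {s : W → W → ℂ} (hadd : ∀ x y z, s (x + y) z = s x z + s y z)
    (hsmul : ∀ (c : ℂ) (x y : W), s (c • x) y = c * s x y) (hsymm : ∀ x y, s y x = starRingEnd ℂ (s x y))
    (hPQ : ∀ p ∈ P, ∀ q ∈ Q, s p q = 0) (hdefP : ∀ p ∈ P, s p p = 0 → p = 0) (hdefQ : ∀ q ∈ Q, s q q = 0 → q = 0)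
    (hadj : ∀ X ∈ 𝔊, ∃ Y ∈ 𝔊, ∀ x y, s (X x) y = s x (Y y))
    (hS : ∀ B' ∈ 𝔊, Θ * B' = B' → B' * Θ = -B' →
      Module.finrank ℂ (LinearMap.range B') = 0 ∨ Module.finrank ℂ (LinearMap.range B') = 14 ∨ Module.finrank ℂ (LinearMap.range B') = 15 ∨ Module.finrank ℂ (LinearMap.range B') = 16 ∨ Module.finrank ℂ (LinearMap.range B') = 17 ∨ Module.finrank ℂ (LinearMap.range B') = 18 ∨ Module.finrank ℂ (LinearMap.range B') = 19 ∨ Module.finrank ℂ (LinearMap.range B') = 20 ∨ Module.finrank ℂ (LinearMap.range B') = 21 ∨ Module.finrank ℂ (LinearMap.range B') = 22 ∨ Module.finrank ℂ (LinearMap.range B') = 23 ∨ Module.finrank ℂ (LinearMap.range B') = 24 ∨ Module.finrank ℂ (LinearMap.range B') = 25 ∨ Module.finrank ℂ (LinearMap.range B') = 26 ∨ Module.finrank ℂ (LinearMap.range B') = 27 ∨ Module.finrank ℂ (LinearMap.range B') = 28 ∨ Module.finrank ℂ (LinearMap.range B') = 29 ∨ Module.finrank ℂ (LinearMap.range B')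 = 30 ∨ Module.finrank ℂ (LinearMap.range B') = 31 ∨ Module.finrank ℂ (LinearMap.range B') = 32 ∨ Module.finrank ℂ (LinearMap.range B') = 33 ∨ Module.finrank ℂ (LinearMap.range B') = 34 ∨ Module.finrank ℂ (LinearMap.range B') = 35)
    {B : Module.End ℂ W} (hB : B ∈ 𝔊) (hΘB : Θ * B = B) (hBΘ : B * Θ = -B)
    (hr : Module.finrank ℂ (LinearMap.range B) = 14) : False := by
  classical
  have hsU : ∀ U : Submodule ℂ W, ∀ x y z : U, s ((x + y : U) : W) z = s (x : W) z + s (y : W) z :=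
    fun U x y z => by simp only [Submodule.coe_add, hadd]
  have hsmU : ∀ U : Submodule ℂ W, ∀ (c : ℂ) (x y : U), s ((c • x : U) : W) y = c * s (x : W) y :=
    fun U c x y => by simp only [Submodule.coe_smul, hsmul]
  have hno1 : ∀ B' ∈ 𝔊, Θ * B' = B' → B' * Θ = -B' → Module.finrank ℂ (LinearMap.range B') ≠ 1 := by
    intro B' hB' hΘB' hB'Θ h1
    rcases hS B' hB' hΘB' hB'Θ with h | h | h | h | h | h | h | h | h | h | h | h | h | h | h | h | h | h | h | h | h | h | h <;> omega
  have hmin : ∀ Y ∈ 𝔊, Θ * Y = Y → Y * Θ = -Y → Y ≠ 0 → 14 ≤ Module.finrank ℂ (LinearMap.range Y) := by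
    intro Y hY hΘY hYΘ hY0
    have h0 : Module.finrank ℂ (LinearMap.range Y) ≠ 0 := fun h =>
      hY0 (LinearMap.range_eq_bot.1 (Submodule.finrank_eq_zero.1 h))
    rcases hS Y hY hΘY hYΘ with h | h | h | h | h | h | h | h | h | h | h | h | h | h | h | h | h | h | h | h | h | h | h <;> omega
  have hmin' : ∀ Z ∈ 𝔊, Θ * Z = Z → Z * Θ = -Z → Z ≠ 0 → Module.finrank ℂ (LinearMap.range B) ≤ Module.finrank ℂ (LinearMap.range Z) := by
    rw [hr]; exact hmin
  obtain ⟨ι, Um, Up, PU, QU, Lm, ιm, Pm, Qm, Lp, ιp, Pp, Qp, hιmem, hιι, hιΘ, hιs, hUm, hUp, hfinUm, hfinUp,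
    hPM, hQM, hPU, hQU, hrangeP, hPUP, hQUQ, hfinQM, hfinPU, hfinQU, hLm, hLp,
    hιmapply, hPmmem, hQmmem, hbrLm, hirrLm, hιmmem, hιmιm, hPm, hQm, hfinPm, hfinQm, hPmQm, hdefPm, hdefQm, hadjLm,
    hιpapply, hPpmem, hQpmem, hbrLp, hirrLp, hιpmem, hιpιp, hPp, hQp, hfinPp, hfinQp, hPpQp, hdefPp, hdefQp, hadjLp,
    hsplit⟩ :=
    UnitaryLeviSetup.exists_levi_pair hbr hirr hΘ hΘΘ hP hQ hadd hsymm hPQ hdefP hdefQ hadj hB hΘB hBΘ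
  have hdich : ∀ X ∈ 𝔊, Θ * X = X → X * Θ = -X → X * ι = ι * X →
      Module.finrank ℂ (Up.map X) + Module.finrank ℂ (Um.map X) ≤ Module.finrank ℂ (LinearMap.range B) ∨
        (14 ≤ Module.finrank ℂ (Up.map X) ∧ 14 ≤ Module.finrank ℂ (Um.map X)) := fun X hX hΘX hXΘ hXc =>
    UnitaryLeviSetup.profile_dichotomy hbr hΘΘ hP hQ hadd hsymm hPQ hdefP hdefQ hadj hmin hB hΘB hBΘ hιι hιΘ hιs hUm hUp
      hPM hQM hQU hfinQU hrangeP hX hΘX hXΘ hXc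
  have hfinQU' := hfinQU
  rw [hr] at hfinQM hfinPU hfinQU hfinPm hfinQm hfinPp hfinQp hsplit hdich
  rw [hQ54] at hfinQM hfinQm hfinUm
  rw [hP35] at hfinPU hfinPp hfinUp
  have hcm : ∀ Z : Module.End ℂ W, Z * ι = ι * Z → ∀ x ∈ Um, Z x ∈ Um := fun Z hZ x hx =>
    (hUm _).2 (by rw [← Module.End.mul_apply, ← hZ, Module.End.mul_apply, (hUm x).1 hx, map_neg])
  have hcp : ∀ Z : Module.End ℂ W, Z * ι = ι * Z → ∀ x ∈ Up, Z x ∈ Up := fun Z hZ x hx =>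
    (hUp _).2 (by rw [← Module.End.mul_apply, ← hZ, Module.End.mul_apply, (hUp x).1 hx])
  have hfullm_of : Lm = ⊤ → False := fun h =>
    UnitaryLeviSetup.false_of_full_larger hbr hΘΘ hno1 hιι hιΘ hUm hUp (by omega) (by omega) hPM hQM (by omega)
      (by omega) hLm h
  have hkillm1 : ∀ X ∈ 𝔊, Θ * X = X → X * Θ = -X → X * ι = ι * X → Module.finrank ℂ (Um.map X) ≠ 1 := by
    intro X hX hΘX hXΘ hXc h1
    obtain ⟨hxmem, hιmx, hxιm, hxrk⟩ := UnitaryLeviSetup.restrict_mem hcm hLm hιmapply X hX hΘX hXΘ hXc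
    rw [h1] at hxrk
    exact hfullm_of (UnitaryRankOneRaise.eq_top_of_rankOne_raise hbrLm hirrLm hιmmem hιmιm hPm hQm
      (s := fun v w : Um => s (v : W) w) (hsU Um) (fun v w => hsymm v w) hPmQm hdefPm hdefQm hadjLm hxmem hιmx hxιm
      hxrk (by omega) (by omega) (by omega))
  have hkillm3 : ∀ X ∈ 𝔊, Θ * X = X → X * Θ = -X → X * ι = ι * X → Module.finrank ℂ (Um.map X) ≠ 3 := by
    intro X hX hΘX hXΘ hXc h3
    obtain ⟨hxmem, hιmx, hxιm, hxrk⟩ := UnitaryLeviSetup.restrict_mem hcm hLm hιmapply X hX hΘX hXΘ hXc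
    rw [h3] at hxrk
    refine hfullm_of (UnitaryDoubleLevi.eq_top_of_raise_of_core hbrLm hirrLm hιmmem hιmιm hPm hQm
      (s := fun v w : Um => s (v : W) w) (hsU Um) (fun v w => hsymm v w) hPmQm hdefPm hdefQm hadjLm hxmem hιmx hxιm
      (by rw [hxrk]; omega) (by omega) (by omega)
      fun U' 𝔩' ι' P' Q' hbr𝔩' hirr𝔩' hι' hι'ι' hP' hQ' hfinP' hfinQ' hP'Q' hdefP' hdefQ' hadj𝔩' => ?_)
    rw [hxrk] at hfinP' hfinQ'
    exact UnitaryThreeCoprime.eq_top hbr𝔩' hirr𝔩' hι' hι'ι' hP' hQ' hfinP' (by omega) (s := fun x y : U' => s ((x : Um) : W) y) (fun x y z => by simp only [Submodule.coe_add, hadd]) (fun x y => hsymm _ _) hP'Q' hdefP' hdefQ' hadj𝔩'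
  have hkillm7 : ∀ X ∈ 𝔊, Θ * X = X → X * Θ = -X → X * ι = ι * X → Module.finrank ℂ (Um.map X) ≠ 7 := by
    intro X hX hΘX hXΘ hXc h7
    obtain ⟨hxmem, hιmx, hxιm, hxrk⟩ := UnitaryLeviSetup.restrict_mem hcm hLm hιmapply X hX hΘX hXΘ hXc
    rw [h7] at hxrk
    refine hfullm_of (UnitaryDoubleLevi.eq_top_of_raise_of_core hbrLm hirrLm hιmmem hιmιm hPm hQm
      (s := fun v w : Um => s (v : W) w) (hsU Um) (fun v w => hsymm v w) hPmQm hdefPm hdefQm hadjLm hxmem hιmx hxιm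
      (by rw [hxrk]; omega) (by omega) (by omega)
      fun U' 𝔩' ι' P' Q' hbr𝔩' hirr𝔩' hι' hι'ι' hP' hQ' hfinP' hfinQ' hP'Q' hdefP' hdefQ' hadj𝔩' => ?_)
    rw [hxrk] at hfinP' hfinQ'
    exact UnitarySeven.eq_top_of_smul hbr𝔩' hirr𝔩' hι' hι'ι' hP' hQ' hfinP' (by omega) (s := fun x y : U' => s ((x : Um) : W) y) (fun x y z => by simp only [Submodule.coe_add, hadd]) (fun c x y => by simp only [Submodule.coe_smul, hsmul]) (fun x y => hsymm _ _) hP'Q' hdefP' hdefQ' hadj𝔩'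
  have hkillm11 : ∀ X ∈ 𝔊, Θ * X = X → X * Θ = -X → X * ι = ι * X → Module.finrank ℂ (Um.map X) ≠ 11 := by
    intro X hX hΘX hXΘ hXc h11
    obtain ⟨hxmem, hιmx, hxιm, hxrk⟩ := UnitaryLeviSetup.restrict_mem hcm hLm hιmapply X hX hΘX hXΘ hXc
    rw [h11] at hxrk
    refine hfullm_of (UnitaryDoubleLevi.eq_top_of_raise_of_core hbrLm hirrLm hιmmem hιmιm hPm hQm
      (s := fun v w : Um => s (v : W) w) (hsU Um) (fun v w => hsymm v w) hPmQm hdefPm hdefQm hadjLm hxmem hιmx hxιm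
      (by rw [hxrk]; omega) (by omega) (by omega)
      fun U' 𝔩' ι' P' Q' hbr𝔩' hirr𝔩' hι' hι'ι' hP' hQ' hfinP' hfinQ' hP'Q' hdefP' hdefQ' hadj𝔩' => ?_)
    rw [hxrk] at hfinP' hfinQ'
    exact UnitaryEleven.eq_top_of_smul hbr𝔩' hirr𝔩' hι' hι'ι' hP' hQ' hfinP' (by omega) (s := fun x y : U' => s ((x : Um) : W) y) (fun x y z => by simp only [Submodule.coe_add, hadd]) (fun c x y => by simp only [Submodule.coe_smul, hsmul]) (fun x y => hsymm _ _) hP'Q' hdefP' hdefQ' hadj𝔩'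
  have hkillm13 : ∀ X ∈ 𝔊, Θ * X = X → X * Θ = -X → X * ι = ι * X → Module.finrank ℂ (Um.map X) ≠ 13 := by
    intro X hX hΘX hXΘ hXc h13
    obtain ⟨hxmem, hιmx, hxιm, hxrk⟩ := UnitaryLeviSetup.restrict_mem hcm hLm hιmapply X hX hΘX hXΘ hXc
    rw [h13] at hxrk
    refine hfullm_of (UnitaryDoubleLevi.eq_top_of_raise_of_core hbrLm hirrLm hιmmem hιmιm hPm hQm
      (s := fun v w : Um => s (v : W) w) (hsU Um) (fun v w => hsymm v w) hPmQm hdefPm hdefQm hadjLm hxmem hιmx hxιm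
      (by rw [hxrk]; omega) (by omega) (by omega)
      fun U' 𝔩' ι' P' Q' hbr𝔩' hirr𝔩' hι' hι'ι' hP' hQ' hfinP' hfinQ' hP'Q' hdefP' hdefQ' hadj𝔩' => ?_)
    rw [hxrk] at hfinP' hfinQ'
    exact UnitaryThirteen.eq_top_of_smul hbr𝔩' hirr𝔩' hι' hι'ι' hP' hQ' hfinP' (by omega) (s := fun x y : U' => s ((x : Um) : W) y) (fun x y z => by simp only [Submodule.coe_add, hadd]) (fun c x y => by simp only [Submodule.coe_smul, hsmul]) (fun x y => hsymm _ _) hP'Q' hdefP' hdefQ' hadj𝔩'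
  have hfullp_of : Lp = ⊤ → False := by
    intro hLptop
    obtain ⟨T1, hιT1, hT1ι, hT1r⟩ := UnitaryRaisingSpace.exists_raise_finrank_range_eq hιpιp hPp hQp (k := 1)
      (by omega) (by omega)
    obtain ⟨X1, hX1, hΘX1, hX1Θ, hX1c, hX1Up⟩ := UnitaryLeviSetup.exists_lift hbr hΘ hΘΘ hcp hιΘ hLp hιpapply T1
      (by rw [hLptop]; exact Submodule.mem_top) hιT1 hT1ι
    rw [hT1r] at hX1Up
    obtain ⟨hs1, hi1, hi1', hj1, hj1'⟩ := hsplit X1 hΘX1 hX1Θ hX1c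
    have hrk1 := hS X1 hX1 hΘX1 hX1Θ
    have hd1 := hdich X1 hX1 hΘX1 hX1Θ hX1c
    rw [hs1] at hrk1
    rw [hX1Up] at hrk1 hd1
    have hk_hkillm13 := hkillm13 X1 hX1 hΘX1 hX1Θ hX1c
    omega
  have hkillp2 : ∀ X ∈ 𝔊, Θ * X = X → X * Θ = -X → X * ι = ι * X → Module.finrank ℂ (Up.map X) ≠ 2 := by
    intro X hX hΘX hXΘ hXc h2
    obtain ⟨hymem, hιpy, hyιp, hyrk⟩ := UnitaryLeviSetup.restrict_mem hcp hLp hιpapply X hX hΘX hXΘ hXc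
    rw [h2] at hyrk
    refine hfullp_of (UnitaryDoubleLevi.eq_top_of_raise_of_core' hbrLp hirrLp hιpmem hιpιp hPp hQp
      (s := fun v w : Up => s (v : W) w) (hsU Up) (fun v w => hsymm v w) hPpQp hdefPp hdefQp hadjLp hymem hιpy hyιp
      (by rw [hyrk]; omega) (by omega) (by omega)
      fun U' 𝔩' ι' P' Q' hbr𝔩' hirr𝔩' hι' hι'ι' hP' hQ' hfinP' hfinQ' hP'Q' hdefP' hdefQ' hadj𝔩' => ?_)
    rw [hyrk] at hfinP' hfinQ'
    exact UnitaryTwoOdd.eq_top hbr𝔩' hirr𝔩' hι' hι'ι' hP' hQ' hfinP' ⟨9, by omega⟩ (s := fun x y : U' => s ((x : Up) : W) y) (fun x y z => by simp only [Submodule.coe_add, hadd]) (fun x y => hsymm _ _) hP'Q' hdefP' hdefQ' hadj𝔩'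
  have hkillp4 : ∀ X ∈ 𝔊, Θ * X = X → X * Θ = -X → X * ι = ι * X → Module.finrank ℂ (Up.map X) ≠ 4 := by
    intro X hX hΘX hXΘ hXc h4
    obtain ⟨hymem, hιpy, hyιp, hyrk⟩ := UnitaryLeviSetup.restrict_mem hcp hLp hιpapply X hX hΘX hXΘ hXc
    rw [h4] at hyrk
    refine hfullp_of (UnitaryDoubleLevi.eq_top_of_raise_of_core' hbrLp hirrLp hιpmem hιpιp hPp hQp
      (s := fun v w : Up => s (v : W) w) (hsU Up) (fun v w => hsymm v w) hPpQp hdefPp hdefQp hadjLp hymem hιpy hyιp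
      (by rw [hyrk]; omega) (by omega) (by omega)
      fun U' 𝔩' ι' P' Q' hbr𝔩' hirr𝔩' hι' hι'ι' hP' hQ' hfinP' hfinQ' hP'Q' hdefP' hdefQ' hadj𝔩' => ?_)
    rw [hyrk] at hfinP' hfinQ'
    exact UnitaryFourOdd.eq_top hbr𝔩' hirr𝔩' hι' hι'ι' hP' hQ' hfinP' ⟨8, by omega⟩ (s := fun x y : U' => s ((x : Up) : W) y) (fun x y z => by simp only [Submodule.coe_add, hadd]) (fun x y => hsymm _ _) hP'Q' hdefP' hdefQ' hadj𝔩'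
  have hkillp5 : ∀ X ∈ 𝔊, Θ * X = X → X * Θ = -X → X * ι = ι * X → Module.finrank ℂ (Up.map X) ≠ 5 := by
    intro X hX hΘX hXΘ hXc h5
    obtain ⟨hymem, hιpy, hyιp, hyrk⟩ := UnitaryLeviSetup.restrict_mem hcp hLp hιpapply X hX hΘX hXΘ hXc
    rw [h5] at hyrk
    refine hfullp_of (UnitaryDoubleLevi.eq_top_of_raise_of_core' hbrLp hirrLp hιpmem hιpιp hPp hQp
      (s := fun v w : Up => s (v : W) w) (hsU Up) (fun v w => hsymm v w) hPpQp hdefPp hdefQp hadjLp hymem hιpy hyιp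
      (by rw [hyrk]; omega) (by omega) (by omega)
      fun U' 𝔩' ι' P' Q' hbr𝔩' hirr𝔩' hι' hι'ι' hP' hQ' hfinP' hfinQ' hP'Q' hdefP' hdefQ' hadj𝔩' => ?_)
    rw [hyrk] at hfinP' hfinQ'
    exact UnitaryFive.eq_top_of_smul hbr𝔩' hirr𝔩' hι' hι'ι' hP' hQ' hfinP' (by omega) (s := fun x y : U' => s ((x : Up) : W) y) (fun x y z => by simp only [Submodule.coe_add, hadd]) (fun c x y => by simp only [Submodule.coe_smul, hsmul]) (fun x y => hsymm _ _) hP'Q' hdefP' hdefQ' hadj𝔩'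
  have hkillp8 : ∀ X ∈ 𝔊, Θ * X = X → X * Θ = -X → X * ι = ι * X → Module.finrank ℂ (Up.map X) ≠ 8 := by
    intro X hX hΘX hXΘ hXc h8
    obtain ⟨hymem, hιpy, hyιp, hyrk⟩ := UnitaryLeviSetup.restrict_mem hcp hLp hιpapply X hX hΘX hXΘ hXc
    rw [h8] at hyrk
    refine hfullp_of (UnitaryDoubleLevi.eq_top_of_raise_of_core' hbrLp hirrLp hιpmem hιpιp hPp hQp
      (s := fun v w : Up => s (v : W) w) (hsU Up) (fun v w => hsymm v w) hPpQp hdefPp hdefQp hadjLp hymem hιpy hyιp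
      (by rw [hyrk]; omega) (by omega) (by omega)
      fun U' 𝔩' ι' P' Q' hbr𝔩' hirr𝔩' hι' hι'ι' hP' hQ' hfinP' hfinQ' hP'Q' hdefP' hdefQ' hadj𝔩' => ?_)
    rw [hyrk] at hfinP' hfinQ'
    exact UnitaryThirteen.eq_top_of_smul' hbr𝔩' hirr𝔩' hι' hι'ι' hP' hQ' (by omega) (by omega) (s := fun x y : U' => s ((x : Up) : W) y) (fun x y z => by simp only [Submodule.coe_add, hadd]) (fun c x y => by simp only [Submodule.coe_smul, hsmul]) (fun x y => hsymm _ _) hP'Q' hdefP' hdefQ' hadj𝔩'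
  have hkillp10 : ∀ X ∈ 𝔊, Θ * X = X → X * Θ = -X → X * ι = ι * X → Module.finrank ℂ (Up.map X) ≠ 10 := by
    intro X hX hΘX hXΘ hXc h10
    obtain ⟨hymem, hιpy, hyιp, hyrk⟩ := UnitaryLeviSetup.restrict_mem hcp hLp hιpapply X hX hΘX hXΘ hXc
    rw [h10] at hyrk
    refine hfullp_of (UnitaryDoubleLevi.eq_top_of_raise_of_core' hbrLp hirrLp hιpmem hιpιp hPp hQp
      (s := fun v w : Up => s (v : W) w) (hsU Up) (fun v w => hsymm v w) hPpQp hdefPp hdefQp hadjLp hymem hιpy hyιp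
      (by rw [hyrk]; omega) (by omega) (by omega)
      fun U' 𝔩' ι' P' Q' hbr𝔩' hirr𝔩' hι' hι'ι' hP' hQ' hfinP' hfinQ' hP'Q' hdefP' hdefQ' hadj𝔩' => ?_)
    rw [hyrk] at hfinP' hfinQ'
    exact UnitaryEleven.eq_top_of_smul' hbr𝔩' hirr𝔩' hι' hι'ι' hP' hQ' (by omega) (by omega) (s := fun x y : U' => s ((x : Up) : W) y) (fun x y z => by simp only [Submodule.coe_add, hadd]) (fun c x y => by simp only [Submodule.coe_smul, hsmul]) (fun x y => hsymm _ _) hP'Q' hdefP' hdefQ' hadj𝔩'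
  have hprof : ∀ X ∈ 𝔊, Θ * X = X → X * Θ = -X → X * ι = ι * X →
      (Module.finrank ℂ (Up.map X) = 0 ∧ Module.finrank ℂ (Um.map X) = 0) ∨
        (Module.finrank ℂ (Up.map X) = 0 ∧ Module.finrank ℂ (Um.map X) = 14) ∨
        (Module.finrank ℂ (Up.map X) = 6 ∧ Module.finrank ℂ (Um.map X) = 8) ∨
        (Module.finrank ℂ (Up.map X) = 9 ∧ Module.finrank ℂ (Um.map X) = 5) ∨
        (Module.finrank ℂ (Up.map X) = 12 ∧ Module.finrank ℂ (Um.map X) = 2) ∨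
        (Module.finrank ℂ (Up.map X) = 14 ∧ Module.finrank ℂ (Um.map X) = 0) ∨
        (Module.finrank ℂ (Up.map X) = 14 ∧ Module.finrank ℂ (Um.map X) = 14) := by
    intro X hX hΘX hXΘ hXc
    obtain ⟨hs, hi, hi', hj, hj'⟩ := hsplit X hΘX hXΘ hXc
    have hkillm1' := hkillm1 X hX hΘX hXΘ hXc
    have hkillm3' := hkillm3 X hX hΘX hXΘ hXc
    have hkillm7' := hkillm7 X hX hΘX hXΘ hXc
    have hkillm11' := hkillm11 X hX hΘX hXΘ hXc
    have hkillm13' := hkillm13 X hX hΘX hXΘ hXc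
    have hkillp2' := hkillp2 X hX hΘX hXΘ hXc
    have hkillp4' := hkillp4 X hX hΘX hXΘ hXc
    have hkillp5' := hkillp5 X hX hΘX hXΘ hXc
    have hkillp8' := hkillp8 X hX hΘX hXΘ hXc
    have hkillp10' := hkillp10 X hX hΘX hXΘ hXc
    have hrk := hS X hX hΘX hXΘ
    have hd := hdich X hX hΘX hXΘ hXc
    rw [hs] at hrk
    generalize Module.finrank ℂ ↥(Submodule.map X Um) = jj at *
    have hjle : jj ≤ 14 := by omega
    interval_cases jj
    · rcases (show Module.finrank ℂ (Up.map X) = 0 ∨ Module.finrank ℂ (Up.map X) = 14 by omega) with h | h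
      · exact Or.inl ⟨h, rfl⟩
      · exact Or.inr (Or.inr (Or.inr (Or.inr (Or.inr (Or.inl ⟨h, rfl⟩)))))
    · exact (hkillm1' rfl).elim
    · exact Or.inr (Or.inr (Or.inr (Or.inr (Or.inl ⟨by omega, rfl⟩))))
    · exact (hkillm3' rfl).elim
    · exfalso; omega
    · exact Or.inr (Or.inr (Or.inr (Or.inl ⟨by omega, rfl⟩)))
    · exfalso; omega
    · exact (hkillm7' rfl).elim
    · exact Or.inr (Or.inr (Or.inl ⟨by omega, rfl⟩))
    · exfalso; omega
    · exfalso; omega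
    · exact (hkillm11' rfl).elim
    · exfalso; omega
    · exact (hkillm13' rfl).elim
    · rcases (show Module.finrank ℂ (Up.map X) = 0 ∨ Module.finrank ℂ (Up.map X) = 14 by omega) with h | h
      · exact Or.inr (Or.inl ⟨h, rfl⟩)
      · exact Or.inr (Or.inr (Or.inr (Or.inr (Or.inr (Or.inr (⟨h, rfl⟩))))))
  obtain ⟨⟨p, hp⟩, hp0⟩ := Module.finrank_pos_iff_exists_ne_zero.1 (show 0 < Module.finrank ℂ PU by omega)
  obtain ⟨⟨q, hq⟩, hq0⟩ := Module.finrank_pos_iff_exists_ne_zero.1 (show 0 < Module.finrank ℂ QU by omega)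
  obtain ⟨X₀, hX₀, hΘX₀, hX₀Θ, hX₀c, c₀, hιc₀, -, hX₀c0⟩ :=
    UnitaryLeviFull.exists_raise_commute_apply_ne_zero hbr hirr hΘ hΘΘ hQ hιmem hιι hιΘ hUm hUp
      ⟨p, fun h => hp0 (Subtype.ext h), ((hPU p).1 hp).1, ((hPU p).1 hp).2⟩
      ⟨q, fun h => hq0 (Subtype.ext h), ((hQU q).1 hq).1, ((hQU q).1 hq).2⟩
  have hX₀i : Module.finrank ℂ (Up.map X₀) ≠ 0 := fun h0 => by
    have hmem : X₀ c₀ ∈ Up.map X₀ := Submodule.mem_map_of_mem ((hUp c₀).2 hιc₀)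
    rw [Submodule.finrank_eq_zero.1 h0, Submodule.mem_bot] at hmem
    exact hX₀c0 hmem
  -- the raising ranks of `L⁺` lie in {0, 6, 9, 12, 14}
  have hSsub : ∀ A ∈ Lp, ιp * A = A → A * ιp = -A → Module.finrank ℂ (LinearMap.range A) = 0 ∨ Module.finrank ℂ (LinearMap.range A) = 6 ∨ Module.finrank ℂ (LinearMap.range A) = 9 ∨ Module.finrank ℂ (LinearMap.range A) = 12 ∨ Module.finrank ℂ (LinearMap.range A) = 14 := by
    intro A hA hιA hAι
    by_cases hA0 : A = 0
    · exact Or.inl (by rw [hA0, LinearMap.range_zero, finrank_bot])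
    · obtain ⟨XA, hXA, hΘXA, hXAΘ, hXAc, hXAU⟩ := UnitaryLeviSetup.exists_lift hbr hΘ hΘΘ hcp hιΘ hLp hιpapply A hA hιA hAι
      have hA0' : Module.finrank ℂ (LinearMap.range A) ≠ 0 := fun h =>
        hA0 (LinearMap.range_eq_bot.1 (Submodule.finrank_eq_zero.1 h))
      have hpA := hprof XA hXA hΘXA hXAΘ hXAc
      rw [← hXAU] at hA0' ⊢
      omega
  obtain ⟨hymem, hιy, hyι, hyrk⟩ := UnitaryLeviSetup.restrict_mem hcp hLp hιpapply X₀ hX₀ hΘX₀ hX₀Θ hX₀c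
  obtain ⟨A₀, hA₀, hιA₀, hA₀ι, hA₀0, hA₀min⟩ := UnitaryRaisingSpace.exists_minRank_raise Lp ιp
    ⟨_, hymem, hιy, hyι, fun h => by rw [h, LinearMap.range_zero, finrank_bot] at hyrk; omega⟩
  have hr0 : Module.finrank ℂ (LinearMap.range A₀) ≠ 0 := fun h =>
    hA₀0 (LinearMap.range_eq_bot.1 (Submodule.finrank_eq_zero.1 h))
  rcases hSsub A₀ hA₀ hιA₀ hA₀ι with hrA | hrA | hrA | hrA | hrA
  · exact hr0 hrA
  · refine UnitaryThirtyFiveFortyFour.subTwentyOneFourteen_ranks6_9_12_14_min6 hbrLp hirrLp hιpmem hιpιp hPp hQp (by omega) (by omega)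
      (s := fun v w : Up => s (v : W) w) (hsU Up) (hsmU Up) (fun v w => hsymm v w) hPpQp hdefPp hdefQp hadjLp
      (fun A hA hιA hAι => ?_) hA₀ hιA₀ hA₀ι hrA
    have h1 := hSsub A hA hιA hAι
    by_cases hA0 : A = 0
    · exact Or.inl (by rw [hA0, LinearMap.range_zero, finrank_bot])
    · have h2 := hA₀min A hA hιA hAι hA0
      omega
  · refine UnitaryThirtyFiveFortyFour.subTwentyOneFourteen_ranks9_12_14_min9 hbrLp hirrLp hιpmem hιpιp hPp hQp (by omega) (by omega)
      (s := fun v w : Up => s (v : W) w) (hsU Up) (hsmU Up) (fun v w => hsymm v w) hPpQp hdefPp hdefQp hadjLp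
      (fun A hA hιA hAι => ?_) hA₀ hιA₀ hA₀ι hrA
    have h1 := hSsub A hA hιA hAι
    by_cases hA0 : A = 0
    · exact Or.inl (by rw [hA0, LinearMap.range_zero, finrank_bot])
    · have h2 := hA₀min A hA hιA hAι hA0
      omega
  · refine UnitaryThirtyFiveThirtyEight.subTwentyOneFourteen_ranks12_14_min12 hbrLp hirrLp hιpmem hιpιp hPp hQp (by omega) (by omega)
      (s := fun v w : Up => s (v : W) w) (hsU Up) (hsmU Up) (fun v w => hsymm v w) hPpQp hdefPp hdefQp hadjLp
      (fun A hA hιA hAι => ?_) hA₀ hιA₀ hA₀ι hrA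
    have h1 := hSsub A hA hιA hAι
    by_cases hA0 : A = 0
    · exact Or.inl (by rw [hA0, LinearMap.range_zero, finrank_bot])
    · have h2 := hA₀min A hA hιA hAι hA0
      omega
  · refine UnitaryThirtyFiveThirtyEight.subTwentyOneFourteen_rank14 hbrLp hirrLp hιpmem hιpιp hPp hQp (by omega) (by omega)
      (s := fun v w : Up => s (v : W) w) (hsU Up) (hsmU Up) (fun v w => hsymm v w) hPpQp hdefPp hdefQp hadjLp
      (fun A hA hιA hAι => ?_) hA₀ hιA₀ hA₀ι hrA
    have h1 := hSsub A hA hιA hAι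
    by_cases hA0 : A = 0
    · exact Or.inl (by rw [hA0, LinearMap.range_zero, finrank_bot])
    · have h2 := hA₀min A hA hιA hAι hA0
      omega

/-- `(35 | 54)`, minimal rank `15`: after the Levi kills the profiles are [(0, 0), (0, 15), (2, 13), (5, 10), (6, 9), (12, 3), (15, 0), (15, 15)], so `L⁺` (type `(20 | 15)`) is a `Θ`-algebra with non-zero raising ranks in `{2, 5, 6, 12, 15}` — impossible by the sub-Levi lemmas. [cite: Ribet1983, Thm. 3] [cite: Gordon1997, Thm. 6.3 (3)]
[cite: Deligne1982HodgeCycles, I §3 Prop. 3.4, 3.6] [cite: GoodmanWallachGTM255, §4.1.1] -/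
theorem UnitaryThirtyFiveFiftyFour.no_minRank_15 [FiniteDimensional ℂ W] {𝔊 : Submodule ℂ (Module.End ℂ W)}
    (hbr : ∀ Y ∈ 𝔊, ∀ Z ∈ 𝔊, Y * Z - Z * Y ∈ 𝔊)
    (hirr : ∀ U : Submodule ℂ W, (∀ A ∈ 𝔊, ∀ u ∈ U, A u ∈ U) → U = ⊥ ∨ U = ⊤)
    {Θ : Module.End ℂ W} (hΘ : Θ ∈ 𝔊) (hΘΘ : Θ * Θ = 1)
    {P Q : Submodule ℂ W} (hP : ∀ x, x ∈ P ↔ Θ x = x) (hQ : ∀ x, x ∈ Q ↔ Θ x = -x)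
    (hP35 : Module.finrank ℂ P = 35) (hQ54 : Module.finrank ℂ Q = 54)
    {s : W → W → ℂ} (hadd : ∀ x y z, s (x + y) z = s x z + s y z)
    (hsmul : ∀ (c : ℂ) (x y : W), s (c • x) y = c * s x y) (hsymm : ∀ x y, s y x = starRingEnd ℂ (s x y))
    (hPQ : ∀ p ∈ P, ∀ q ∈ Q, s p q = 0) (hdefP : ∀ p ∈ P, s p p = 0 → p = 0) (hdefQ : ∀ q ∈ Q, s q q = 0 → q = 0)
    (hadj : ∀ X ∈ 𝔊, ∃ Y ∈ 𝔊, ∀ x y, s (X x) y = s x (Y y))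
    (hS : ∀ B' ∈ 𝔊, Θ * B' = B' → B' * Θ = -B' →
      Module.finrank ℂ (LinearMap.range B') = 0 ∨ Module.finrank ℂ (LinearMap.range B') = 15 ∨ Module.finrank ℂ (LinearMap.range B') = 16 ∨ Module.finrank ℂ (LinearMap.range B') = 17 ∨ Module.finrank ℂ (LinearMap.range B') = 18 ∨ Module.finrank ℂ (LinearMap.range B') = 19 ∨ Module.finrank ℂ (LinearMap.range B') = 20 ∨ Module.finrank ℂ (LinearMap.range B') = 21 ∨ Module.finrank ℂ (LinearMap.range B') = 22 ∨ Module.finrank ℂ (LinearMap.range B') = 23 ∨ Module.finrank ℂ (LinearMap.range B') = 24 ∨ Module.finrank ℂ (LinearMap.range B') = 25 ∨ Module.finrank ℂ (LinearMap.range B') = 26 ∨ Module.finrank ℂ (LinearMap.range B') = 27 ∨ Module.finrank ℂ (LinearMap.range B') = 28 ∨ Module.finrank ℂ (LinearMap.range B') = 29 ∨ Module.finrank ℂ (LinearMap.range B') = 30 ∨ Module.finrank ℂ (LinearMap.range B') = 31 ∨ Module.finrank ℂ (LinearMap.range B') = 32 ∨ Module.finrank ℂ (LinearMap.range B') = 33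 ∨ Module.finrank ℂ (LinearMap.range B') = 34 ∨ Module.finrank ℂ (LinearMap.range B') = 35)
    {B : Module.End ℂ W} (hB : B ∈ 𝔊) (hΘB : Θ * B = B) (hBΘ : B * Θ = -B)
    (hr : Module.finrank ℂ (LinearMap.range B) = 15) : False := by
  classical
  have hsU : ∀ U : Submodule ℂ W, ∀ x y z : U, s ((x + y : U) : W) z = s (x : W) z + s (y : W) z :=
    fun U x y z => by simp only [Submodule.coe_add, hadd]
  have hsmU : ∀ U : Submodule ℂ W, ∀ (c : ℂ) (x y : U), s ((c • x : U) : W) y = c * s (x : W) y :=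
    fun U c x y => by simp only [Submodule.coe_smul, hsmul]
  have hno1 : ∀ B' ∈ 𝔊, Θ * B' = B' → B' * Θ = -B' → Module.finrank ℂ (LinearMap.range B') ≠ 1 := by
    intro B' hB' hΘB' hB'Θ h1
    rcases hS B' hB' hΘB' hB'Θ with h | h | h | h | h | h | h | h | h | h | h | h | h | h | h | h | h | h | h | h | h | h <;> omega
  have hmin : ∀ Y ∈ 𝔊, Θ * Y = Y → Y * Θ = -Y → Y ≠ 0 → 15 ≤ Module.finrank ℂ (LinearMap.range Y) := by
    intro Y hY hΘY hYΘ hY0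
    have h0 : Module.finrank ℂ (LinearMap.range Y) ≠ 0 := fun h =>
      hY0 (LinearMap.range_eq_bot.1 (Submodule.finrank_eq_zero.1 h))
    rcases hS Y hY hΘY hYΘ with h | h | h | h | h | h | h | h | h | h | h | h | h | h | h | h | h | h | h | h | h | h <;> omega
  have hmin' : ∀ Z ∈ 𝔊, Θ * Z = Z → Z * Θ = -Z → Z ≠ 0 → Module.finrank ℂ (LinearMap.range B) ≤ Module.finrank ℂ (LinearMap.range Z) := by
    rw [hr]; exact hmin
  obtain ⟨ι, Um, Up, PU, QU, Lm, ιm, Pm, Qm, Lp, ιp, Pp, Qp, hιmem, hιι, hιΘ, hιs, hUm, hUp, hfinUm, hfinUp,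
    hPM, hQM, hPU, hQU, hrangeP, hPUP, hQUQ, hfinQM, hfinPU, hfinQU, hLm, hLp,
    hιmapply, hPmmem, hQmmem, hbrLm, hirrLm, hιmmem, hιmιm, hPm, hQm, hfinPm, hfinQm, hPmQm, hdefPm, hdefQm, hadjLm,
    hιpapply, hPpmem, hQpmem, hbrLp, hirrLp, hιpmem, hιpιp, hPp, hQp, hfinPp, hfinQp, hPpQp, hdefPp, hdefQp, hadjLp,
    hsplit⟩ :=
    UnitaryLeviSetup.exists_levi_pair hbr hirr hΘ hΘΘ hP hQ hadd hsymm hPQ hdefP hdefQ hadj hB hΘB hBΘ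
  have hdich : ∀ X ∈ 𝔊, Θ * X = X → X * Θ = -X → X * ι = ι * X →
      Module.finrank ℂ (Up.map X) + Module.finrank ℂ (Um.map X) ≤ Module.finrank ℂ (LinearMap.range B) ∨
        (15 ≤ Module.finrank ℂ (Up.map X) ∧ 15 ≤ Module.finrank ℂ (Um.map X)) := fun X hX hΘX hXΘ hXc =>
    UnitaryLeviSetup.profile_dichotomy hbr hΘΘ hP hQ hadd hsymm hPQ hdefP hdefQ hadj hmin hB hΘB hBΘ hιι hιΘ hιs hUm hUp
      hPM hQM hQU hfinQU hrangeP hX hΘX hXΘ hXc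
  have hfinQU' := hfinQU
  rw [hr] at hfinQM hfinPU hfinQU hfinPm hfinQm hfinPp hfinQp hsplit hdich
  rw [hQ54] at hfinQM hfinQm hfinUm
  rw [hP35] at hfinPU hfinPp hfinUp
  have hcm : ∀ Z : Module.End ℂ W, Z * ι = ι * Z → ∀ x ∈ Um, Z x ∈ Um := fun Z hZ x hx =>
    (hUm _).2 (by rw [← Module.End.mul_apply, ← hZ, Module.End.mul_apply, (hUm x).1 hx, map_neg])
  have hcp : ∀ Z : Module.End ℂ W, Z * ι = ι * Z → ∀ x ∈ Up, Z x ∈ Up := fun Z hZ x hx =>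
    (hUp _).2 (by rw [← Module.End.mul_apply, ← hZ, Module.End.mul_apply, (hUp x).1 hx])
  have hfullm_of : Lm = ⊤ → False := fun h =>
    UnitaryLeviSetup.false_of_full_larger hbr hΘΘ hno1 hιι hιΘ hUm hUp (by omega) (by omega) hPM hQM (by omega)
      (by omega) hLm h
  have hkillm1 : ∀ X ∈ 𝔊, Θ * X = X → X * Θ = -X → X * ι = ι * X → Module.finrank ℂ (Um.map X) ≠ 1 := by
    intro X hX hΘX hXΘ hXc h1
    obtain ⟨hxmem, hιmx, hxιm, hxrk⟩ := UnitaryLeviSetup.restrict_mem hcm hLm hιmapply X hX hΘX hXΘ hXc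
    rw [h1] at hxrk
    exact hfullm_of (UnitaryRankOneRaise.eq_top_of_rankOne_raise hbrLm hirrLm hιmmem hιmιm hPm hQm
      (s := fun v w : Um => s (v : W) w) (hsU Um) (fun v w => hsymm v w) hPmQm hdefPm hdefQm hadjLm hxmem hιmx hxιm
      hxrk (by omega) (by omega) (by omega))
  have hkillm2 : ∀ X ∈ 𝔊, Θ * X = X → X * Θ = -X → X * ι = ι * X → Module.finrank ℂ (Um.map X) ≠ 2 := by
    intro X hX hΘX hXΘ hXc h2
    obtain ⟨hxmem, hιmx, hxιm, hxrk⟩ := UnitaryLeviSetup.restrict_mem hcm hLm hιmapply X hX hΘX hXΘ hXc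
    rw [h2] at hxrk
    refine hfullm_of (UnitaryDoubleLevi.eq_top_of_raise_of_core hbrLm hirrLm hιmmem hιmιm hPm hQm
      (s := fun v w : Um => s (v : W) w) (hsU Um) (fun v w => hsymm v w) hPmQm hdefPm hdefQm hadjLm hxmem hιmx hxιm
      (by rw [hxrk]; omega) (by omega) (by omega)
      fun U' 𝔩' ι' P' Q' hbr𝔩' hirr𝔩' hι' hι'ι' hP' hQ' hfinP' hfinQ' hP'Q' hdefP' hdefQ' hadj𝔩' => ?_)
    rw [hxrk] at hfinP' hfinQ'
    exact UnitaryTwoOdd.eq_top hbr𝔩' hirr𝔩' hι' hι'ι' hP' hQ' hfinP' ⟨18, by omega⟩ (s := fun x y : U' => s ((x : Um) : W) y) (fun x y z => by simp only [Submodule.coe_add, hadd]) (fun x y => hsymm _ _) hP'Q' hdefP' hdefQ' hadj𝔩'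
  have hkillm4 : ∀ X ∈ 𝔊, Θ * X = X → X * Θ = -X → X * ι = ι * X → Module.finrank ℂ (Um.map X) ≠ 4 := by
    intro X hX hΘX hXΘ hXc h4
    obtain ⟨hxmem, hιmx, hxιm, hxrk⟩ := UnitaryLeviSetup.restrict_mem hcm hLm hιmapply X hX hΘX hXΘ hXc
    rw [h4] at hxrk
    refine hfullm_of (UnitaryDoubleLevi.eq_top_of_raise_of_core hbrLm hirrLm hιmmem hιmιm hPm hQm
      (s := fun v w : Um => s (v : W) w) (hsU Um) (fun v w => hsymm v w) hPmQm hdefPm hdefQm hadjLm hxmem hιmx hxιm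
      (by rw [hxrk]; omega) (by omega) (by omega)
      fun U' 𝔩' ι' P' Q' hbr𝔩' hirr𝔩' hι' hι'ι' hP' hQ' hfinP' hfinQ' hP'Q' hdefP' hdefQ' hadj𝔩' => ?_)
    rw [hxrk] at hfinP' hfinQ'
    exact UnitaryFourOdd.eq_top hbr𝔩' hirr𝔩' hι' hι'ι' hP' hQ' hfinP' ⟨17, by omega⟩ (s := fun x y : U' => s ((x : Um) : W) y) (fun x y z => by simp only [Submodule.coe_add, hadd]) (fun x y => hsymm _ _) hP'Q' hdefP' hdefQ' hadj𝔩'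
  have hkillm5 : ∀ X ∈ 𝔊, Θ * X = X → X * Θ = -X → X * ι = ι * X → Module.finrank ℂ (Um.map X) ≠ 5 := by
    intro X hX hΘX hXΘ hXc h5
    obtain ⟨hxmem, hιmx, hxιm, hxrk⟩ := UnitaryLeviSetup.restrict_mem hcm hLm hιmapply X hX hΘX hXΘ hXc
    rw [h5] at hxrk
    refine hfullm_of (UnitaryDoubleLevi.eq_top_of_raise_of_core hbrLm hirrLm hιmmem hιmιm hPm hQm
      (s := fun v w : Um => s (v : W) w) (hsU Um) (fun v w => hsymm v w) hPmQm hdefPm hdefQm hadjLm hxmem hιmx hxιm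
      (by rw [hxrk]; omega) (by omega) (by omega)
      fun U' 𝔩' ι' P' Q' hbr𝔩' hirr𝔩' hι' hι'ι' hP' hQ' hfinP' hfinQ' hP'Q' hdefP' hdefQ' hadj𝔩' => ?_)
    rw [hxrk] at hfinP' hfinQ'
    exact UnitaryFive.eq_top_of_smul hbr𝔩' hirr𝔩' hι' hι'ι' hP' hQ' hfinP' (by omega) (s := fun x y : U' => s ((x : Um) : W) y) (fun x y z => by simp only [Submodule.coe_add, hadd]) (fun c x y => by simp only [Submodule.coe_smul, hsmul]) (fun x y => hsymm _ _) hP'Q' hdefP' hdefQ' hadj𝔩'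
  have hkillm7 : ∀ X ∈ 𝔊, Θ * X = X → X * Θ = -X → X * ι = ι * X → Module.finrank ℂ (Um.map X) ≠ 7 := by
    intro X hX hΘX hXΘ hXc h7
    obtain ⟨hxmem, hιmx, hxιm, hxrk⟩ := UnitaryLeviSetup.restrict_mem hcm hLm hιmapply X hX hΘX hXΘ hXc
    rw [h7] at hxrk
    refine hfullm_of (UnitaryDoubleLevi.eq_top_of_raise_of_core hbrLm hirrLm hιmmem hιmιm hPm hQm
      (s := fun v w : Um => s (v : W) w) (hsU Um) (fun v w => hsymm v w) hPmQm hdefPm hdefQm hadjLm hxmem hιmx hxιm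
      (by rw [hxrk]; omega) (by omega) (by omega)
      fun U' 𝔩' ι' P' Q' hbr𝔩' hirr𝔩' hι' hι'ι' hP' hQ' hfinP' hfinQ' hP'Q' hdefP' hdefQ' hadj𝔩' => ?_)
    rw [hxrk] at hfinP' hfinQ'
    exact UnitarySeven.eq_top_of_smul hbr𝔩' hirr𝔩' hι' hι'ι' hP' hQ' hfinP' (by omega) (s := fun x y : U' => s ((x : Um) : W) y) (fun x y z => by simp only [Submodule.coe_add, hadd]) (fun c x y => by simp only [Submodule.coe_smul, hsmul]) (fun x y => hsymm _ _) hP'Q' hdefP' hdefQ' hadj𝔩'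
  have hkillm11 : ∀ X ∈ 𝔊, Θ * X = X → X * Θ = -X → X * ι = ι * X → Module.finrank ℂ (Um.map X) ≠ 11 := by
    intro X hX hΘX hXΘ hXc h11
    obtain ⟨hxmem, hιmx, hxιm, hxrk⟩ := UnitaryLeviSetup.restrict_mem hcm hLm hιmapply X hX hΘX hXΘ hXc
    rw [h11] at hxrk
    refine hfullm_of (UnitaryDoubleLevi.eq_top_of_raise_of_core hbrLm hirrLm hιmmem hιmιm hPm hQm
      (s := fun v w : Um => s (v : W) w) (hsU Um) (fun v w => hsymm v w) hPmQm hdefPm hdefQm hadjLm hxmem hιmx hxιm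
      (by rw [hxrk]; omega) (by omega) (by omega)
      fun U' 𝔩' ι' P' Q' hbr𝔩' hirr𝔩' hι' hι'ι' hP' hQ' hfinP' hfinQ' hP'Q' hdefP' hdefQ' hadj𝔩' => ?_)
    rw [hxrk] at hfinP' hfinQ'
    exact UnitaryEleven.eq_top_of_smul hbr𝔩' hirr𝔩' hι' hι'ι' hP' hQ' hfinP' (by omega) (s := fun x y : U' => s ((x : Um) : W) y) (fun x y z => by simp only [Submodule.coe_add, hadd]) (fun c x y => by simp only [Submodule.coe_smul, hsmul]) (fun x y => hsymm _ _) hP'Q' hdefP' hdefQ' hadj𝔩'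
  have hfullp_of : Lp = ⊤ → False := by
    intro hLptop
    obtain ⟨T4, hιT4, hT4ι, hT4r⟩ := UnitaryRaisingSpace.exists_raise_finrank_range_eq hιpιp hPp hQp (k := 4)
      (by omega) (by omega)
    obtain ⟨X4, hX4, hΘX4, hX4Θ, hX4c, hX4Up⟩ := UnitaryLeviSetup.exists_lift hbr hΘ hΘΘ hcp hιΘ hLp hιpapply T4
      (by rw [hLptop]; exact Submodule.mem_top) hιT4 hT4ι
    rw [hT4r] at hX4Up
    obtain ⟨hs4, hi4, hi4', hj4, hj4'⟩ := hsplit X4 hΘX4 hX4Θ hX4c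
    have hrk4 := hS X4 hX4 hΘX4 hX4Θ
    have hd4 := hdich X4 hX4 hΘX4 hX4Θ hX4c
    rw [hs4] at hrk4
    rw [hX4Up] at hrk4 hd4
    have hk_hkillm11 := hkillm11 X4 hX4 hΘX4 hX4Θ hX4c
    omega
  have hkillp1 : ∀ X ∈ 𝔊, Θ * X = X → X * Θ = -X → X * ι = ι * X → Module.finrank ℂ (Up.map X) ≠ 1 := by
    intro X hX hΘX hXΘ hXc h1
    obtain ⟨hymem, hιpy, hyιp, hyrk⟩ := UnitaryLeviSetup.restrict_mem hcp hLp hιpapply X hX hΘX hXΘ hXc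
    rw [h1] at hyrk
    exact hfullp_of (UnitaryRankOneRaise.eq_top_of_rankOne_raise hbrLp hirrLp hιpmem hιpιp hPp hQp
      (s := fun v w : Up => s (v : W) w) (hsU Up) (fun v w => hsymm v w) hPpQp hdefPp hdefQp hadjLp hymem hιpy hyιp
      hyrk (by omega) (by omega) (by omega))
  have hkillp3 : ∀ X ∈ 𝔊, Θ * X = X → X * Θ = -X → X * ι = ι * X → Module.finrank ℂ (Up.map X) ≠ 3 := by
    intro X hX hΘX hXΘ hXc h3
    obtain ⟨hymem, hιpy, hyιp, hyrk⟩ := UnitaryLeviSetup.restrict_mem hcp hLp hιpapply X hX hΘX hXΘ hXc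
    rw [h3] at hyrk
    refine hfullp_of (UnitaryDoubleLevi.eq_top_of_raise_of_core' hbrLp hirrLp hιpmem hιpιp hPp hQp
      (s := fun v w : Up => s (v : W) w) (hsU Up) (fun v w => hsymm v w) hPpQp hdefPp hdefQp hadjLp hymem hιpy hyιp
      (by rw [hyrk]; omega) (by omega) (by omega)
      fun U' 𝔩' ι' P' Q' hbr𝔩' hirr𝔩' hι' hι'ι' hP' hQ' hfinP' hfinQ' hP'Q' hdefP' hdefQ' hadj𝔩' => ?_)
    rw [hyrk] at hfinP' hfinQ'
    exact UnitaryThreeCoprime.eq_top hbr𝔩' hirr𝔩' hι' hι'ι' hP' hQ' hfinP' (by omega) (s := fun x y : U' => s ((x : Up) : W) y) (fun x y z => by simp only [Submodule.coe_add, hadd]) (fun x y => hsymm _ _) hP'Q' hdefP' hdefQ' hadj𝔩'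
  have hkillp7 : ∀ X ∈ 𝔊, Θ * X = X → X * Θ = -X → X * ι = ι * X → Module.finrank ℂ (Up.map X) ≠ 7 := by
    intro X hX hΘX hXΘ hXc h7
    obtain ⟨hymem, hιpy, hyιp, hyrk⟩ := UnitaryLeviSetup.restrict_mem hcp hLp hιpapply X hX hΘX hXΘ hXc
    rw [h7] at hyrk
    refine hfullp_of (UnitaryDoubleLevi.eq_top_of_raise_of_core' hbrLp hirrLp hιpmem hιpιp hPp hQp
      (s := fun v w : Up => s (v : W) w) (hsU Up) (fun v w => hsymm v w) hPpQp hdefPp hdefQp hadjLp hymem hιpy hyιp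
      (by rw [hyrk]; omega) (by omega) (by omega)
      fun U' 𝔩' ι' P' Q' hbr𝔩' hirr𝔩' hι' hι'ι' hP' hQ' hfinP' hfinQ' hP'Q' hdefP' hdefQ' hadj𝔩' => ?_)
    rw [hyrk] at hfinP' hfinQ'
    exact UnitarySeven.eq_top_of_smul hbr𝔩' hirr𝔩' hι' hι'ι' hP' hQ' hfinP' (by omega) (s := fun x y : U' => s ((x : Up) : W) y) (fun x y z => by simp only [Submodule.coe_add, hadd]) (fun c x y => by simp only [Submodule.coe_smul, hsmul]) (fun x y => hsymm _ _) hP'Q' hdefP' hdefQ' hadj𝔩'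
  have hkillp9 : ∀ X ∈ 𝔊, Θ * X = X → X * Θ = -X → X * ι = ι * X → Module.finrank ℂ (Up.map X) ≠ 9 := by
    intro X hX hΘX hXΘ hXc h9
    obtain ⟨hymem, hιpy, hyιp, hyrk⟩ := UnitaryLeviSetup.restrict_mem hcp hLp hιpapply X hX hΘX hXΘ hXc
    rw [h9] at hyrk
    refine hfullp_of (UnitaryDoubleLevi.eq_top_of_raise_of_core' hbrLp hirrLp hιpmem hιpιp hPp hQp
      (s := fun v w : Up => s (v : W) w) (hsU Up) (fun v w => hsymm v w) hPpQp hdefPp hdefQp hadjLp hymem hιpy hyιp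
      (by rw [hyrk]; omega) (by omega) (by omega)
      fun U' 𝔩' ι' P' Q' hbr𝔩' hirr𝔩' hι' hι'ι' hP' hQ' hfinP' hfinQ' hP'Q' hdefP' hdefQ' hadj𝔩' => ?_)
    rw [hyrk] at hfinP' hfinQ'
    exact UnitaryEleven.eq_top_of_smul' hbr𝔩' hirr𝔩' hι' hι'ι' hP' hQ' (by omega) (by omega) (s := fun x y : U' => s ((x : Up) : W) y) (fun x y z => by simp only [Submodule.coe_add, hadd]) (fun c x y => by simp only [Submodule.coe_smul, hsmul]) (fun x y => hsymm _ _) hP'Q' hdefP' hdefQ' hadj𝔩'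
  have hprof : ∀ X ∈ 𝔊, Θ * X = X → X * Θ = -X → X * ι = ι * X →
      (Module.finrank ℂ (Up.map X) = 0 ∧ Module.finrank ℂ (Um.map X) = 0) ∨
        (Module.finrank ℂ (Up.map X) = 0 ∧ Module.finrank ℂ (Um.map X) = 15) ∨
        (Module.finrank ℂ (Up.map X) = 2 ∧ Module.finrank ℂ (Um.map X) = 13) ∨
        (Module.finrank ℂ (Up.map X) = 5 ∧ Module.finrank ℂ (Um.map X) = 10) ∨
        (Module.finrank ℂ (Up.map X) = 6 ∧ Module.finrank ℂ (Um.map X) = 9) ∨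
        (Module.finrank ℂ (Up.map X) = 12 ∧ Module.finrank ℂ (Um.map X) = 3) ∨
        (Module.finrank ℂ (Up.map X) = 15 ∧ Module.finrank ℂ (Um.map X) = 0) ∨
        (Module.finrank ℂ (Up.map X) = 15 ∧ Module.finrank ℂ (Um.map X) = 15) := by
    intro X hX hΘX hXΘ hXc
    obtain ⟨hs, hi, hi', hj, hj'⟩ := hsplit X hΘX hXΘ hXc
    have hkillm1' := hkillm1 X hX hΘX hXΘ hXc
    have hkillm2' := hkillm2 X hX hΘX hXΘ hXc
    have hkillm4' := hkillm4 X hX hΘX hXΘ hXc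
    have hkillm5' := hkillm5 X hX hΘX hXΘ hXc
    have hkillm7' := hkillm7 X hX hΘX hXΘ hXc
    have hkillm11' := hkillm11 X hX hΘX hXΘ hXc
    have hkillp1' := hkillp1 X hX hΘX hXΘ hXc
    have hkillp3' := hkillp3 X hX hΘX hXΘ hXc
    have hkillp7' := hkillp7 X hX hΘX hXΘ hXc
    have hkillp9' := hkillp9 X hX hΘX hXΘ hXc
    have hrk := hS X hX hΘX hXΘ
    have hd := hdich X hX hΘX hXΘ hXc
    rw [hs] at hrk
    generalize Module.finrank ℂ ↥(Submodule.map X Um) = jj at *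
    have hjle : jj ≤ 15 := by omega
    interval_cases jj
    · rcases (show Module.finrank ℂ (Up.map X) = 0 ∨ Module.finrank ℂ (Up.map X) = 15 by omega) with h | h
      · exact Or.inl ⟨h, rfl⟩
      · exact Or.inr (Or.inr (Or.inr (Or.inr (Or.inr (Or.inr (Or.inl ⟨h, rfl⟩))))))
    · exact (hkillm1' rfl).elim
    · exact (hkillm2' rfl).elim
    · exact Or.inr (Or.inr (Or.inr (Or.inr (Or.inr (Or.inl ⟨by omega, rfl⟩)))))
    · exact (hkillm4' rfl).elim
    · exact (hkillm5' rfl).elim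
    · exfalso; omega
    · exact (hkillm7' rfl).elim
    · exfalso; omega
    · exact Or.inr (Or.inr (Or.inr (Or.inr (Or.inl ⟨by omega, rfl⟩))))
    · exact Or.inr (Or.inr (Or.inr (Or.inl ⟨by omega, rfl⟩)))
    · exact (hkillm11' rfl).elim
    · exfalso; omega
    · exact Or.inr (Or.inr (Or.inl ⟨by omega, rfl⟩))
    · exfalso; omega
    · rcases (show Module.finrank ℂ (Up.map X) = 0 ∨ Module.finrank ℂ (Up.map X) = 15 by omega) with h | h
      · exact Or.inr (Or.inl ⟨h, rfl⟩)
      · exact Or.inr (Or.inr (Or.inr (Or.inr (Or.inr (Or.inr (Or.inr (⟨h, rfl⟩)))))))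
  obtain ⟨⟨p, hp⟩, hp0⟩ := Module.finrank_pos_iff_exists_ne_zero.1 (show 0 < Module.finrank ℂ PU by omega)
  obtain ⟨⟨q, hq⟩, hq0⟩ := Module.finrank_pos_iff_exists_ne_zero.1 (show 0 < Module.finrank ℂ QU by omega)
  obtain ⟨X₀, hX₀, hΘX₀, hX₀Θ, hX₀c, c₀, hιc₀, -, hX₀c0⟩ :=
    UnitaryLeviFull.exists_raise_commute_apply_ne_zero hbr hirr hΘ hΘΘ hQ hιmem hιι hιΘ hUm hUp
      ⟨p, fun h => hp0 (Subtype.ext h), ((hPU p).1 hp).1, ((hPU p).1 hp).2⟩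
      ⟨q, fun h => hq0 (Subtype.ext h), ((hQU q).1 hq).1, ((hQU q).1 hq).2⟩
  have hX₀i : Module.finrank ℂ (Up.map X₀) ≠ 0 := fun h0 => by
    have hmem : X₀ c₀ ∈ Up.map X₀ := Submodule.mem_map_of_mem ((hUp c₀).2 hιc₀)
    rw [Submodule.finrank_eq_zero.1 h0, Submodule.mem_bot] at hmem
    exact hX₀c0 hmem
  -- the raising ranks of `L⁺` lie in {0, 2, 5, 6, 12, 15}
  have hSsub : ∀ A ∈ Lp, ιp * A = A → A * ιp = -A → Module.finrank ℂ (LinearMap.range A) = 0 ∨ Module.finrank ℂ (LinearMap.range A) = 2 ∨ Module.finrank ℂ (LinearMap.range A) = 5 ∨ Module.finrank ℂ (LinearMap.range A) = 6 ∨ Module.finrank ℂ (LinearMap.range A) = 12 ∨ Module.finrank ℂ (LinearMap.range A) = 15 := by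
    intro A hA hιA hAι
    by_cases hA0 : A = 0
    · exact Or.inl (by rw [hA0, LinearMap.range_zero, finrank_bot])
    · obtain ⟨XA, hXA, hΘXA, hXAΘ, hXAc, hXAU⟩ := UnitaryLeviSetup.exists_lift hbr hΘ hΘΘ hcp hιΘ hLp hιpapply A hA hιA hAι
      have hA0' : Module.finrank ℂ (LinearMap.range A) ≠ 0 := fun h =>
        hA0 (LinearMap.range_eq_bot.1 (Submodule.finrank_eq_zero.1 h))
      have hpA := hprof XA hXA hΘXA hXAΘ hXAc
      rw [← hXAU] at hA0' ⊢
      omega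
  obtain ⟨hymem, hιy, hyι, hyrk⟩ := UnitaryLeviSetup.restrict_mem hcp hLp hιpapply X₀ hX₀ hΘX₀ hX₀Θ hX₀c
  obtain ⟨A₀, hA₀, hιA₀, hA₀ι, hA₀0, hA₀min⟩ := UnitaryRaisingSpace.exists_minRank_raise Lp ιp
    ⟨_, hymem, hιy, hyι, fun h => by rw [h, LinearMap.range_zero, finrank_bot] at hyrk; omega⟩
  have hr0 : Module.finrank ℂ (LinearMap.range A₀) ≠ 0 := fun h =>
    hA₀0 (LinearMap.range_eq_bot.1 (Submodule.finrank_eq_zero.1 h))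
  rcases hSsub A₀ hA₀ hιA₀ hA₀ι with hrA | hrA | hrA | hrA | hrA | hrA
  · exact hr0 hrA
  · refine UnitaryThirtyFiveFiftyFour.subTwentyFifteen_ranks2_5_6_12_15_min2 hbrLp hirrLp hιpmem hιpιp hPp hQp (by omega) (by omega)
      (s := fun v w : Up => s (v : W) w) (hsU Up) (hsmU Up) (fun v w => hsymm v w) hPpQp hdefPp hdefQp hadjLp
      (fun A hA hιA hAι => ?_) hA₀ hιA₀ hA₀ι hrA
    have h1 := hSsub A hA hιA hAι
    by_cases hA0 : A = 0
    · exact Or.inl (by rw [hA0, LinearMap.range_zero, finrank_bot])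
    · have h2 := hA₀min A hA hιA hAι hA0
      omega
  · refine UnitaryThirtyFiveFortyEight.subTwentyFifteen_ranks5_6_12_15_min5 hbrLp hirrLp hιpmem hιpιp hPp hQp (by omega) (by omega)
      (s := fun v w : Up => s (v : W) w) (hsU Up) (hsmU Up) (fun v w => hsymm v w) hPpQp hdefPp hdefQp hadjLp
      (fun A hA hιA hAι => ?_) hA₀ hιA₀ hA₀ι hrA
    have h1 := hSsub A hA hιA hAι
    by_cases hA0 : A = 0
    · exact Or.inl (by rw [hA0, LinearMap.range_zero, finrank_bot])
    · have h2 := hA₀min A hA hιA hAι hA0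
      omega
  · refine UnitaryThirtyFiveFortyEight.subTwentyFifteen_ranks6_12_15_min6 hbrLp hirrLp hιpmem hιpιp hPp hQp (by omega) (by omega)
      (s := fun v w : Up => s (v : W) w) (hsU Up) (hsmU Up) (fun v w => hsymm v w) hPpQp hdefPp hdefQp hadjLp
      (fun A hA hιA hAι => ?_) hA₀ hιA₀ hA₀ι hrA
    have h1 := hSsub A hA hιA hAι
    by_cases hA0 : A = 0
    · exact Or.inl (by rw [hA0, LinearMap.range_zero, finrank_bot])
    · have h2 := hA₀min A hA hιA hAι hA0
      omega
  · refine UnitaryThirtyFiveThirtySix.subTwentyFifteen_ranks12_15_min12 hbrLp hirrLp hιpmem hιpιp hPp hQp (by omega) (by omega)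
      (s := fun v w : Up => s (v : W) w) (hsU Up) (hsmU Up) (fun v w => hsymm v w) hPpQp hdefPp hdefQp hadjLp
      (fun A hA hιA hAι => ?_) hA₀ hιA₀ hA₀ι hrA
    have h1 := hSsub A hA hιA hAι
    by_cases hA0 : A = 0
    · exact Or.inl (by rw [hA0, LinearMap.range_zero, finrank_bot])
    · have h2 := hA₀min A hA hιA hAι hA0
      omega
  · refine UnitaryThirtyFiveThirtySix.subTwentyFifteen_rank15 hbrLp hirrLp hιpmem hιpιp hPp hQp (by omega) (by omega)
      (s := fun v w : Up => s (v : W) w) (hsU Up) (hsmU Up) (fun v w => hsymm v w) hPpQp hdefPp hdefQp hadjLp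
      (fun A hA hιA hAι => ?_) hA₀ hιA₀ hA₀ι hrA
    have h1 := hSsub A hA hιA hAι
    by_cases hA0 : A = 0
    · exact Or.inl (by rw [hA0, LinearMap.range_zero, finrank_bot])
    · have h2 := hA₀min A hA hιA hAι hA0
      omega

/-- `(35 | 54)`, minimal rank `16`: after the Levi kills every profile has `i = 0` (profiles [(0, 0), (0, 16)]), against the non-vanishing lemma. [cite: Ribet1983, Thm. 3] [cite: Gordon1997, Thm. 6.3 (3)]
[cite: Deligne1982HodgeCycles, I §3 Prop. 3.4, 3.6] [cite: GoodmanWallachGTM255, §4.1.1] -/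
theorem UnitaryThirtyFiveFiftyFour.no_minRank_16 [FiniteDimensional ℂ W] {𝔊 : Submodule ℂ (Module.End ℂ W)}
    (hbr : ∀ Y ∈ 𝔊, ∀ Z ∈ 𝔊, Y * Z - Z * Y ∈ 𝔊)
    (hirr : ∀ U : Submodule ℂ W, (∀ A ∈ 𝔊, ∀ u ∈ U, A u ∈ U) → U = ⊥ ∨ U = ⊤)
    {Θ : Module.End ℂ W} (hΘ : Θ ∈ 𝔊) (hΘΘ : Θ * Θ = 1)
    {P Q : Submodule ℂ W} (hP : ∀ x, x ∈ P ↔ Θ x = x) (hQ : ∀ x, x ∈ Q ↔ Θ x = -x)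
    (hP35 : Module.finrank ℂ P = 35) (hQ54 : Module.finrank ℂ Q = 54)
    {s : W → W → ℂ} (hadd : ∀ x y z, s (x + y) z = s x z + s y z)
    (hsmul : ∀ (c : ℂ) (x y : W), s (c • x) y = c * s x y) (hsymm : ∀ x y, s y x = starRingEnd ℂ (s x y))
    (hPQ : ∀ p ∈ P, ∀ q ∈ Q, s p q = 0) (hdefP : ∀ p ∈ P, s p p = 0 → p = 0) (hdefQ : ∀ q ∈ Q, s q q = 0 → q = 0)
    (hadj : ∀ X ∈ 𝔊, ∃ Y ∈ 𝔊, ∀ x y, s (X x) y = s x (Y y))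
    (hS : ∀ B' ∈ 𝔊, Θ * B' = B' → B' * Θ = -B' →
      Module.finrank ℂ (LinearMap.range B') = 0 ∨ Module.finrank ℂ (LinearMap.range B') = 16 ∨ Module.finrank ℂ (LinearMap.range B') = 17 ∨ Module.finrank ℂ (LinearMap.range B') = 18 ∨ Module.finrank ℂ (LinearMap.range B') = 19 ∨ Module.finrank ℂ (LinearMap.range B') = 20 ∨ Module.finrank ℂ (LinearMap.range B') = 21 ∨ Module.finrank ℂ (LinearMap.range B') = 22 ∨ Module.finrank ℂ (LinearMap.range B') = 23 ∨ Module.finrank ℂ (LinearMap.range B') = 24 ∨ Module.finrank ℂ (LinearMap.range B') = 25 ∨ Module.finrank ℂ (LinearMap.range B') = 26 ∨ Module.finrank ℂ (LinearMap.range B') = 27 ∨ Module.finrank ℂ (LinearMap.range B') = 28 ∨ Module.finrank ℂ (LinearMap.range B') = 29 ∨ Module.finrank ℂ (LinearMap.range B') = 30 ∨ Module.finrank ℂ (LinearMap.range B') = 31 ∨ Module.finrank ℂ (LinearMap.range B') = 32 ∨ Module.finrank ℂ (LinearMap.range B') = 33 ∨ Module.finrank ℂ (LinearMap.range B') = 34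 ∨ Module.finrank ℂ (LinearMap.range B') = 35)
    {B : Module.End ℂ W} (hB : B ∈ 𝔊) (hΘB : Θ * B = B) (hBΘ : B * Θ = -B)
    (hr : Module.finrank ℂ (LinearMap.range B) = 16) : False := by
  classical
  have hsU : ∀ U : Submodule ℂ W, ∀ x y z : U, s ((x + y : U) : W) z = s (x : W) z + s (y : W) z :=
    fun U x y z => by simp only [Submodule.coe_add, hadd]
  have hsmU : ∀ U : Submodule ℂ W, ∀ (c : ℂ) (x y : U), s ((c • x : U) : W) y = c * s (x : W) y :=
    fun U c x y => by simp only [Submodule.coe_smul, hsmul]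
  have hno1 : ∀ B' ∈ 𝔊, Θ * B' = B' → B' * Θ = -B' → Module.finrank ℂ (LinearMap.range B') ≠ 1 := by
    intro B' hB' hΘB' hB'Θ h1
    rcases hS B' hB' hΘB' hB'Θ with h | h | h | h | h | h | h | h | h | h | h | h | h | h | h | h | h | h | h | h | h <;> omega
  have hmin : ∀ Y ∈ 𝔊, Θ * Y = Y → Y * Θ = -Y → Y ≠ 0 → 16 ≤ Module.finrank ℂ (LinearMap.range Y) := by
    intro Y hY hΘY hYΘ hY0
    have h0 : Module.finrank ℂ (LinearMap.range Y) ≠ 0 := fun h =>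
      hY0 (LinearMap.range_eq_bot.1 (Submodule.finrank_eq_zero.1 h))
    rcases hS Y hY hΘY hYΘ with h | h | h | h | h | h | h | h | h | h | h | h | h | h | h | h | h | h | h | h | h <;> omega
  have hmin' : ∀ Z ∈ 𝔊, Θ * Z = Z → Z * Θ = -Z → Z ≠ 0 → Module.finrank ℂ (LinearMap.range B) ≤ Module.finrank ℂ (LinearMap.range Z) := by
    rw [hr]; exact hmin
  obtain ⟨ι, Um, Up, PU, QU, Lm, ιm, Pm, Qm, Lp, ιp, Pp, Qp, hιmem, hιι, hιΘ, hιs, hUm, hUp, hfinUm, hfinUp,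
    hPM, hQM, hPU, hQU, hrangeP, hPUP, hQUQ, hfinQM, hfinPU, hfinQU, hLm, hLp,
    hιmapply, hPmmem, hQmmem, hbrLm, hirrLm, hιmmem, hιmιm, hPm, hQm, hfinPm, hfinQm, hPmQm, hdefPm, hdefQm, hadjLm,
    hιpapply, hPpmem, hQpmem, hbrLp, hirrLp, hιpmem, hιpιp, hPp, hQp, hfinPp, hfinQp, hPpQp, hdefPp, hdefQp, hadjLp,
    hsplit⟩ :=
    UnitaryLeviSetup.exists_levi_pair hbr hirr hΘ hΘΘ hP hQ hadd hsymm hPQ hdefP hdefQ hadj hB hΘB hBΘ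
  have hdich : ∀ X ∈ 𝔊, Θ * X = X → X * Θ = -X → X * ι = ι * X →
      Module.finrank ℂ (Up.map X) + Module.finrank ℂ (Um.map X) ≤ Module.finrank ℂ (LinearMap.range B) ∨
        (16 ≤ Module.finrank ℂ (Up.map X) ∧ 16 ≤ Module.finrank ℂ (Um.map X)) := fun X hX hΘX hXΘ hXc =>
    UnitaryLeviSetup.profile_dichotomy hbr hΘΘ hP hQ hadd hsymm hPQ hdefP hdefQ hadj hmin hB hΘB hBΘ hιι hιΘ hιs hUm hUp
      hPM hQM hQU hfinQU hrangeP hX hΘX hXΘ hXc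
  have hfinQU' := hfinQU
  rw [hr] at hfinQM hfinPU hfinQU hfinPm hfinQm hfinPp hfinQp hsplit hdich
  rw [hQ54] at hfinQM hfinQm hfinUm
  rw [hP35] at hfinPU hfinPp hfinUp
  have hcm : ∀ Z : Module.End ℂ W, Z * ι = ι * Z → ∀ x ∈ Um, Z x ∈ Um := fun Z hZ x hx =>
    (hUm _).2 (by rw [← Module.End.mul_apply, ← hZ, Module.End.mul_apply, (hUm x).1 hx, map_neg])
  have hcp : ∀ Z : Module.End ℂ W, Z * ι = ι * Z → ∀ x ∈ Up, Z x ∈ Up := fun Z hZ x hx =>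
    (hUp _).2 (by rw [← Module.End.mul_apply, ← hZ, Module.End.mul_apply, (hUp x).1 hx])
  have hfullm_of : Lm = ⊤ → False := fun h =>
    UnitaryLeviSetup.false_of_full_larger hbr hΘΘ hno1 hιι hιΘ hUm hUp (by omega) (by omega) hPM hQM (by omega)
      (by omega) hLm h
  have hkillm1 : ∀ X ∈ 𝔊, Θ * X = X → X * Θ = -X → X * ι = ι * X → Module.finrank ℂ (Um.map X) ≠ 1 := by
    intro X hX hΘX hXΘ hXc h1
    obtain ⟨hxmem, hιmx, hxιm, hxrk⟩ := UnitaryLeviSetup.restrict_mem hcm hLm hιmapply X hX hΘX hXΘ hXc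
    rw [h1] at hxrk
    exact hfullm_of (UnitaryRankOneRaise.eq_top_of_rankOne_raise hbrLm hirrLm hιmmem hιmιm hPm hQm
      (s := fun v w : Um => s (v : W) w) (hsU Um) (fun v w => hsymm v w) hPmQm hdefPm hdefQm hadjLm hxmem hιmx hxιm
      hxrk (by omega) (by omega) (by omega))
  have hkillm3 : ∀ X ∈ 𝔊, Θ * X = X → X * Θ = -X → X * ι = ι * X → Module.finrank ℂ (Um.map X) ≠ 3 := by
    intro X hX hΘX hXΘ hXc h3
    obtain ⟨hxmem, hιmx, hxιm, hxrk⟩ := UnitaryLeviSetup.restrict_mem hcm hLm hιmapply X hX hΘX hXΘ hXc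
    rw [h3] at hxrk
    refine hfullm_of (UnitaryDoubleLevi.eq_top_of_raise_of_core hbrLm hirrLm hιmmem hιmιm hPm hQm
      (s := fun v w : Um => s (v : W) w) (hsU Um) (fun v w => hsymm v w) hPmQm hdefPm hdefQm hadjLm hxmem hιmx hxιm
      (by rw [hxrk]; omega) (by omega) (by omega)
      fun U' 𝔩' ι' P' Q' hbr𝔩' hirr𝔩' hι' hι'ι' hP' hQ' hfinP' hfinQ' hP'Q' hdefP' hdefQ' hadj𝔩' => ?_)
    rw [hxrk] at hfinP' hfinQ'
    exact UnitaryThreeCoprime.eq_top hbr𝔩' hirr𝔩' hι' hι'ι' hP' hQ' hfinP' (by omega) (s := fun x y : U' => s ((x : Um) : W) y) (fun x y z => by simp only [Submodule.coe_add, hadd]) (fun x y => hsymm _ _) hP'Q' hdefP' hdefQ' hadj𝔩'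
  have hkillm5 : ∀ X ∈ 𝔊, Θ * X = X → X * Θ = -X → X * ι = ι * X → Module.finrank ℂ (Um.map X) ≠ 5 := by
    intro X hX hΘX hXΘ hXc h5
    obtain ⟨hxmem, hιmx, hxιm, hxrk⟩ := UnitaryLeviSetup.restrict_mem hcm hLm hιmapply X hX hΘX hXΘ hXc
    rw [h5] at hxrk
    refine hfullm_of (UnitaryDoubleLevi.eq_top_of_raise_of_core hbrLm hirrLm hιmmem hιmιm hPm hQm
      (s := fun v w : Um => s (v : W) w) (hsU Um) (fun v w => hsymm v w) hPmQm hdefPm hdefQm hadjLm hxmem hιmx hxιm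
      (by rw [hxrk]; omega) (by omega) (by omega)
      fun U' 𝔩' ι' P' Q' hbr𝔩' hirr𝔩' hι' hι'ι' hP' hQ' hfinP' hfinQ' hP'Q' hdefP' hdefQ' hadj𝔩' => ?_)
    rw [hxrk] at hfinP' hfinQ'
    exact UnitaryFive.eq_top_of_smul hbr𝔩' hirr𝔩' hι' hι'ι' hP' hQ' hfinP' (by omega) (s := fun x y : U' => s ((x : Um) : W) y) (fun x y z => by simp only [Submodule.coe_add, hadd]) (fun c x y => by simp only [Submodule.coe_smul, hsmul]) (fun x y => hsymm _ _) hP'Q' hdefP' hdefQ' hadj𝔩'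
  have hkillm7 : ∀ X ∈ 𝔊, Θ * X = X → X * Θ = -X → X * ι = ι * X → Module.finrank ℂ (Um.map X) ≠ 7 := by
    intro X hX hΘX hXΘ hXc h7
    obtain ⟨hxmem, hιmx, hxιm, hxrk⟩ := UnitaryLeviSetup.restrict_mem hcm hLm hιmapply X hX hΘX hXΘ hXc
    rw [h7] at hxrk
    refine hfullm_of (UnitaryDoubleLevi.eq_top_of_raise_of_core hbrLm hirrLm hιmmem hιmιm hPm hQm
      (s := fun v w : Um => s (v : W) w) (hsU Um) (fun v w => hsymm v w) hPmQm hdefPm hdefQm hadjLm hxmem hιmx hxιm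
      (by rw [hxrk]; omega) (by omega) (by omega)
      fun U' 𝔩' ι' P' Q' hbr𝔩' hirr𝔩' hι' hι'ι' hP' hQ' hfinP' hfinQ' hP'Q' hdefP' hdefQ' hadj𝔩' => ?_)
    rw [hxrk] at hfinP' hfinQ'
    exact UnitarySeven.eq_top_of_smul hbr𝔩' hirr𝔩' hι' hι'ι' hP' hQ' hfinP' (by omega) (s := fun x y : U' => s ((x : Um) : W) y) (fun x y z => by simp only [Submodule.coe_add, hadd]) (fun c x y => by simp only [Submodule.coe_smul, hsmul]) (fun x y => hsymm _ _) hP'Q' hdefP' hdefQ' hadj𝔩'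
  have hkillm11 : ∀ X ∈ 𝔊, Θ * X = X → X * Θ = -X → X * ι = ι * X → Module.finrank ℂ (Um.map X) ≠ 11 := by
    intro X hX hΘX hXΘ hXc h11
    obtain ⟨hxmem, hιmx, hxιm, hxrk⟩ := UnitaryLeviSetup.restrict_mem hcm hLm hιmapply X hX hΘX hXΘ hXc
    rw [h11] at hxrk
    refine hfullm_of (UnitaryDoubleLevi.eq_top_of_raise_of_core hbrLm hirrLm hιmmem hιmιm hPm hQm
      (s := fun v w : Um => s (v : W) w) (hsU Um) (fun v w => hsymm v w) hPmQm hdefPm hdefQm hadjLm hxmem hιmx hxιm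
      (by rw [hxrk]; omega) (by omega) (by omega)
      fun U' 𝔩' ι' P' Q' hbr𝔩' hirr𝔩' hι' hι'ι' hP' hQ' hfinP' hfinQ' hP'Q' hdefP' hdefQ' hadj𝔩' => ?_)
    rw [hxrk] at hfinP' hfinQ'
    exact UnitaryEleven.eq_top_of_smul hbr𝔩' hirr𝔩' hι' hι'ι' hP' hQ' hfinP' (by omega) (s := fun x y : U' => s ((x : Um) : W) y) (fun x y z => by simp only [Submodule.coe_add, hadd]) (fun c x y => by simp only [Submodule.coe_smul, hsmul]) (fun x y => hsymm _ _) hP'Q' hdefP' hdefQ' hadj𝔩'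
  have hkillm13 : ∀ X ∈ 𝔊, Θ * X = X → X * Θ = -X → X * ι = ι * X → Module.finrank ℂ (Um.map X) ≠ 13 := by
    intro X hX hΘX hXΘ hXc h13
    obtain ⟨hxmem, hιmx, hxιm, hxrk⟩ := UnitaryLeviSetup.restrict_mem hcm hLm hιmapply X hX hΘX hXΘ hXc
    rw [h13] at hxrk
    refine hfullm_of (UnitaryDoubleLevi.eq_top_of_raise_of_core hbrLm hirrLm hιmmem hιmιm hPm hQm
      (s := fun v w : Um => s (v : W) w) (hsU Um) (fun v w => hsymm v w) hPmQm hdefPm hdefQm hadjLm hxmem hιmx hxιm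
      (by rw [hxrk]; omega) (by omega) (by omega)
      fun U' 𝔩' ι' P' Q' hbr𝔩' hirr𝔩' hι' hι'ι' hP' hQ' hfinP' hfinQ' hP'Q' hdefP' hdefQ' hadj𝔩' => ?_)
    rw [hxrk] at hfinP' hfinQ'
    exact UnitaryThirteen.eq_top_of_smul hbr𝔩' hirr𝔩' hι' hι'ι' hP' hQ' hfinP' (by omega) (s := fun x y : U' => s ((x : Um) : W) y) (fun x y z => by simp only [Submodule.coe_add, hadd]) (fun c x y => by simp only [Submodule.coe_smul, hsmul]) (fun x y => hsymm _ _) hP'Q' hdefP' hdefQ' hadj𝔩'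
  have hfullp_of : Lp = ⊤ → False := by
    intro hLptop
    obtain ⟨T3, hιT3, hT3ι, hT3r⟩ := UnitaryRaisingSpace.exists_raise_finrank_range_eq hιpιp hPp hQp (k := 3)
      (by omega) (by omega)
    obtain ⟨X3, hX3, hΘX3, hX3Θ, hX3c, hX3Up⟩ := UnitaryLeviSetup.exists_lift hbr hΘ hΘΘ hcp hιΘ hLp hιpapply T3
      (by rw [hLptop]; exact Submodule.mem_top) hιT3 hT3ι
    rw [hT3r] at hX3Up
    obtain ⟨hs3, hi3, hi3', hj3, hj3'⟩ := hsplit X3 hΘX3 hX3Θ hX3c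
    have hrk3 := hS X3 hX3 hΘX3 hX3Θ
    have hd3 := hdich X3 hX3 hΘX3 hX3Θ hX3c
    rw [hs3] at hrk3
    rw [hX3Up] at hrk3 hd3
    have hk_hkillm13 := hkillm13 X3 hX3 hΘX3 hX3Θ hX3c
    omega
  have hkillp1 : ∀ X ∈ 𝔊, Θ * X = X → X * Θ = -X → X * ι = ι * X → Module.finrank ℂ (Up.map X) ≠ 1 := by
    intro X hX hΘX hXΘ hXc h1
    obtain ⟨hymem, hιpy, hyιp, hyrk⟩ := UnitaryLeviSetup.restrict_mem hcp hLp hιpapply X hX hΘX hXΘ hXc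
    rw [h1] at hyrk
    exact hfullp_of (UnitaryRankOneRaise.eq_top_of_rankOne_raise hbrLp hirrLp hιpmem hιpιp hPp hQp
      (s := fun v w : Up => s (v : W) w) (hsU Up) (fun v w => hsymm v w) hPpQp hdefPp hdefQp hadjLp hymem hιpy hyιp
      hyrk (by omega) (by omega) (by omega))
  have hkillp2 : ∀ X ∈ 𝔊, Θ * X = X → X * Θ = -X → X * ι = ι * X → Module.finrank ℂ (Up.map X) ≠ 2 := by
    intro X hX hΘX hXΘ hXc h2
    obtain ⟨hymem, hιpy, hyιp, hyrk⟩ := UnitaryLeviSetup.restrict_mem hcp hLp hιpapply X hX hΘX hXΘ hXc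
    rw [h2] at hyrk
    refine hfullp_of (UnitaryDoubleLevi.eq_top_of_raise_of_core' hbrLp hirrLp hιpmem hιpιp hPp hQp
      (s := fun v w : Up => s (v : W) w) (hsU Up) (fun v w => hsymm v w) hPpQp hdefPp hdefQp hadjLp hymem hιpy hyιp
      (by rw [hyrk]; omega) (by omega) (by omega)
      fun U' 𝔩' ι' P' Q' hbr𝔩' hirr𝔩' hι' hι'ι' hP' hQ' hfinP' hfinQ' hP'Q' hdefP' hdefQ' hadj𝔩' => ?_)
    rw [hyrk] at hfinP' hfinQ'
    exact UnitaryTwoOdd.eq_top hbr𝔩' hirr𝔩' hι' hι'ι' hP' hQ' hfinP' ⟨8, by omega⟩ (s := fun x y : U' => s ((x : Up) : W) y) (fun x y z => by simp only [Submodule.coe_add, hadd]) (fun x y => hsymm _ _) hP'Q' hdefP' hdefQ' hadj𝔩'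
  have hkillp4 : ∀ X ∈ 𝔊, Θ * X = X → X * Θ = -X → X * ι = ι * X → Module.finrank ℂ (Up.map X) ≠ 4 := by
    intro X hX hΘX hXΘ hXc h4
    obtain ⟨hymem, hιpy, hyιp, hyrk⟩ := UnitaryLeviSetup.restrict_mem hcp hLp hιpapply X hX hΘX hXΘ hXc
    rw [h4] at hyrk
    refine hfullp_of (UnitaryDoubleLevi.eq_top_of_raise_of_core' hbrLp hirrLp hιpmem hιpιp hPp hQp
      (s := fun v w : Up => s (v : W) w) (hsU Up) (fun v w => hsymm v w) hPpQp hdefPp hdefQp hadjLp hymem hιpy hyιp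
      (by rw [hyrk]; omega) (by omega) (by omega)
      fun U' 𝔩' ι' P' Q' hbr𝔩' hirr𝔩' hι' hι'ι' hP' hQ' hfinP' hfinQ' hP'Q' hdefP' hdefQ' hadj𝔩' => ?_)
    rw [hyrk] at hfinP' hfinQ'
    exact UnitaryFourOdd.eq_top hbr𝔩' hirr𝔩' hι' hι'ι' hP' hQ' hfinP' ⟨7, by omega⟩ (s := fun x y : U' => s ((x : Up) : W) y) (fun x y z => by simp only [Submodule.coe_add, hadd]) (fun x y => hsymm _ _) hP'Q' hdefP' hdefQ' hadj𝔩'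
  have hkillp6 : ∀ X ∈ 𝔊, Θ * X = X → X * Θ = -X → X * ι = ι * X → Module.finrank ℂ (Up.map X) ≠ 6 := by
    intro X hX hΘX hXΘ hXc h6
    obtain ⟨hymem, hιpy, hyιp, hyrk⟩ := UnitaryLeviSetup.restrict_mem hcp hLp hιpapply X hX hΘX hXΘ hXc
    rw [h6] at hyrk
    refine hfullp_of (UnitaryDoubleLevi.eq_top_of_raise_of_core' hbrLp hirrLp hιpmem hιpιp hPp hQp
      (s := fun v w : Up => s (v : W) w) (hsU Up) (fun v w => hsymm v w) hPpQp hdefPp hdefQp hadjLp hymem hιpy hyιp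
      (by rw [hyrk]; omega) (by omega) (by omega)
      fun U' 𝔩' ι' P' Q' hbr𝔩' hirr𝔩' hι' hι'ι' hP' hQ' hfinP' hfinQ' hP'Q' hdefP' hdefQ' hadj𝔩' => ?_)
    rw [hyrk] at hfinP' hfinQ'
    exact UnitarySix.eq_top_of_smul hbr𝔩' hirr𝔩' hι' hι'ι' hP' hQ' hfinP' ⟨6, by omega⟩ (by omega) (s := fun x y : U' => s ((x : Up) : W) y) (fun x y z => by simp only [Submodule.coe_add, hadd]) (fun c x y => by simp only [Submodule.coe_smul, hsmul]) (fun x y => hsymm _ _) hP'Q' hdefP' hdefQ' hadj𝔩'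
  have hkillp7 : ∀ X ∈ 𝔊, Θ * X = X → X * Θ = -X → X * ι = ι * X → Module.finrank ℂ (Up.map X) ≠ 7 := by
    intro X hX hΘX hXΘ hXc h7
    obtain ⟨hymem, hιpy, hyιp, hyrk⟩ := UnitaryLeviSetup.restrict_mem hcp hLp hιpapply X hX hΘX hXΘ hXc
    rw [h7] at hyrk
    refine hfullp_of (UnitaryDoubleLevi.eq_top_of_raise_of_core' hbrLp hirrLp hιpmem hιpιp hPp hQp
      (s := fun v w : Up => s (v : W) w) (hsU Up) (fun v w => hsymm v w) hPpQp hdefPp hdefQp hadjLp hymem hιpy hyιp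
      (by rw [hyrk]; omega) (by omega) (by omega)
      fun U' 𝔩' ι' P' Q' hbr𝔩' hirr𝔩' hι' hι'ι' hP' hQ' hfinP' hfinQ' hP'Q' hdefP' hdefQ' hadj𝔩' => ?_)
    rw [hyrk] at hfinP' hfinQ'
    exact UnitarySeven.eq_top_of_smul hbr𝔩' hirr𝔩' hι' hι'ι' hP' hQ' hfinP' (by omega) (s := fun x y : U' => s ((x : Up) : W) y) (fun x y z => by simp only [Submodule.coe_add, hadd]) (fun c x y => by simp only [Submodule.coe_smul, hsmul]) (fun x y => hsymm _ _) hP'Q' hdefP' hdefQ' hadj𝔩'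
  have hkillp8 : ∀ X ∈ 𝔊, Θ * X = X → X * Θ = -X → X * ι = ι * X → Module.finrank ℂ (Up.map X) ≠ 8 := by
    intro X hX hΘX hXΘ hXc h8
    obtain ⟨hymem, hιpy, hyιp, hyrk⟩ := UnitaryLeviSetup.restrict_mem hcp hLp hιpapply X hX hΘX hXΘ hXc
    rw [h8] at hyrk
    refine hfullp_of (UnitaryDoubleLevi.eq_top_of_raise_of_core' hbrLp hirrLp hιpmem hιpιp hPp hQp
      (s := fun v w : Up => s (v : W) w) (hsU Up) (fun v w => hsymm v w) hPpQp hdefPp hdefQp hadjLp hymem hιpy hyιp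
      (by rw [hyrk]; omega) (by omega) (by omega)
      fun U' 𝔩' ι' P' Q' hbr𝔩' hirr𝔩' hι' hι'ι' hP' hQ' hfinP' hfinQ' hP'Q' hdefP' hdefQ' hadj𝔩' => ?_)
    rw [hyrk] at hfinP' hfinQ'
    exact UnitaryEleven.eq_top_of_smul' hbr𝔩' hirr𝔩' hι' hι'ι' hP' hQ' (by omega) (by omega) (s := fun x y : U' => s ((x : Up) : W) y) (fun x y z => by simp only [Submodule.coe_add, hadd]) (fun c x y => by simp only [Submodule.coe_smul, hsmul]) (fun x y => hsymm _ _) hP'Q' hdefP' hdefQ' hadj𝔩'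
  have hkillp10 : ∀ X ∈ 𝔊, Θ * X = X → X * Θ = -X → X * ι = ι * X → Module.finrank ℂ (Up.map X) ≠ 10 := by
    intro X hX hΘX hXΘ hXc h10
    obtain ⟨hymem, hιpy, hyιp, hyrk⟩ := UnitaryLeviSetup.restrict_mem hcp hLp hιpapply X hX hΘX hXΘ hXc
    rw [h10] at hyrk
    refine hfullp_of (UnitaryDoubleLevi.eq_top_of_raise_of_core' hbrLp hirrLp hιpmem hιpιp hPp hQp
      (s := fun v w : Up => s (v : W) w) (hsU Up) (fun v w => hsymm v w) hPpQp hdefPp hdefQp hadjLp hymem hιpy hyιp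
      (by rw [hyrk]; omega) (by omega) (by omega)
      fun U' 𝔩' ι' P' Q' hbr𝔩' hirr𝔩' hι' hι'ι' hP' hQ' hfinP' hfinQ' hP'Q' hdefP' hdefQ' hadj𝔩' => ?_)
    rw [hyrk] at hfinP' hfinQ'
    exact UnitaryNineTen.eq_top_of_smul' hbr𝔩' hirr𝔩' hι' hι'ι' hP' hQ' hfinP' (by omega) (s := fun x y : U' => s ((x : Up) : W) y) (fun x y z => by simp only [Submodule.coe_add, hadd]) (fun c x y => by simp only [Submodule.coe_smul, hsmul]) (fun x y => hsymm _ _) hP'Q' hdefP' hdefQ' hadj𝔩'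
  have hkillp12 : ∀ X ∈ 𝔊, Θ * X = X → X * Θ = -X → X * ι = ι * X → Module.finrank ℂ (Up.map X) ≠ 12 := by
    intro X hX hΘX hXΘ hXc h12
    obtain ⟨hymem, hιpy, hyιp, hyrk⟩ := UnitaryLeviSetup.restrict_mem hcp hLp hιpapply X hX hΘX hXΘ hXc
    rw [h12] at hyrk
    refine hfullp_of (UnitaryDoubleLevi.eq_top_of_raise_of_core' hbrLp hirrLp hιpmem hιpιp hPp hQp
      (s := fun v w : Up => s (v : W) w) (hsU Up) (fun v w => hsymm v w) hPpQp hdefPp hdefQp hadjLp hymem hιpy hyιp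
      (by rw [hyrk]; omega) (by omega) (by omega)
      fun U' 𝔩' ι' P' Q' hbr𝔩' hirr𝔩' hι' hι'ι' hP' hQ' hfinP' hfinQ' hP'Q' hdefP' hdefQ' hadj𝔩' => ?_)
    rw [hyrk] at hfinP' hfinQ'
    exact UnitarySeven.eq_top_of_smul' hbr𝔩' hirr𝔩' hι' hι'ι' hP' hQ' (by omega) (by omega) (s := fun x y : U' => s ((x : Up) : W) y) (fun x y z => by simp only [Submodule.coe_add, hadd]) (fun c x y => by simp only [Submodule.coe_smul, hsmul]) (fun x y => hsymm _ _) hP'Q' hdefP' hdefQ' hadj𝔩'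
  have hkillp14 : ∀ X ∈ 𝔊, Θ * X = X → X * Θ = -X → X * ι = ι * X → Module.finrank ℂ (Up.map X) ≠ 14 := by
    intro X hX hΘX hXΘ hXc h14
    obtain ⟨hymem, hιpy, hyιp, hyrk⟩ := UnitaryLeviSetup.restrict_mem hcp hLp hιpapply X hX hΘX hXΘ hXc
    rw [h14] at hyrk
    refine hfullp_of (UnitaryDoubleLevi.eq_top_of_raise_of_core' hbrLp hirrLp hιpmem hιpιp hPp hQp
      (s := fun v w : Up => s (v : W) w) (hsU Up) (fun v w => hsymm v w) hPpQp hdefPp hdefQp hadjLp hymem hιpy hyιp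
      (by rw [hyrk]; omega) (by omega) (by omega)
      fun U' 𝔩' ι' P' Q' hbr𝔩' hirr𝔩' hι' hι'ι' hP' hQ' hfinP' hfinQ' hP'Q' hdefP' hdefQ' hadj𝔩' => ?_)
    rw [hyrk] at hfinP' hfinQ'
    exact UnitaryFive.eq_top_of_smul' hbr𝔩' hirr𝔩' hι' hι'ι' hP' hQ' (by omega) (by omega) (s := fun x y : U' => s ((x : Up) : W) y) (fun x y z => by simp only [Submodule.coe_add, hadd]) (fun c x y => by simp only [Submodule.coe_smul, hsmul]) (fun x y => hsymm _ _) hP'Q' hdefP' hdefQ' hadj𝔩'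
  have hkillp16 : ∀ X ∈ 𝔊, Θ * X = X → X * Θ = -X → X * ι = ι * X → Module.finrank ℂ (Up.map X) ≠ 16 := by
    intro X hX hΘX hXΘ hXc h16
    obtain ⟨hymem, hιpy, hyιp, hyrk⟩ := UnitaryLeviSetup.restrict_mem hcp hLp hιpapply X hX hΘX hXΘ hXc
    rw [h16] at hyrk
    refine hfullp_of (UnitaryDoubleLevi.eq_top_of_raise_of_core' hbrLp hirrLp hιpmem hιpιp hPp hQp
      (s := fun v w : Up => s (v : W) w) (hsU Up) (fun v w => hsymm v w) hPpQp hdefPp hdefQp hadjLp hymem hιpy hyιp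
      (by rw [hyrk]; omega) (by omega) (by omega)
      fun U' 𝔩' ι' P' Q' hbr𝔩' hirr𝔩' hι' hι'ι' hP' hQ' hfinP' hfinQ' hP'Q' hdefP' hdefQ' hadj𝔩' => ?_)
    rw [hyrk] at hfinP' hfinQ'
    exact UnitaryThreeCoprime.eq_top' hbr𝔩' hirr𝔩' hι' hι'ι' hP' hQ' (by omega) (by omega) (s := fun x y : U' => s ((x : Up) : W) y) (fun x y z => by simp only [Submodule.coe_add, hadd]) (fun x y => hsymm _ _) hP'Q' hdefP' hdefQ' hadj𝔩'
  have hprof : ∀ X ∈ 𝔊, Θ * X = X → X * Θ = -X → X * ι = ι * X →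
      (Module.finrank ℂ (Up.map X) = 0 ∧ Module.finrank ℂ (Um.map X) = 0) ∨
        (Module.finrank ℂ (Up.map X) = 0 ∧ Module.finrank ℂ (Um.map X) = 16) := by
    intro X hX hΘX hXΘ hXc
    obtain ⟨hs, hi, hi', hj, hj'⟩ := hsplit X hΘX hXΘ hXc
    have hkillm1' := hkillm1 X hX hΘX hXΘ hXc
    have hkillm3' := hkillm3 X hX hΘX hXΘ hXc
    have hkillm5' := hkillm5 X hX hΘX hXΘ hXc
    have hkillm7' := hkillm7 X hX hΘX hXΘ hXc
    have hkillm11' := hkillm11 X hX hΘX hXΘ hXc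
    have hkillm13' := hkillm13 X hX hΘX hXΘ hXc
    have hkillp1' := hkillp1 X hX hΘX hXΘ hXc
    have hkillp2' := hkillp2 X hX hΘX hXΘ hXc
    have hkillp4' := hkillp4 X hX hΘX hXΘ hXc
    have hkillp6' := hkillp6 X hX hΘX hXΘ hXc
    have hkillp7' := hkillp7 X hX hΘX hXΘ hXc
    have hkillp8' := hkillp8 X hX hΘX hXΘ hXc
    have hkillp10' := hkillp10 X hX hΘX hXΘ hXc
    have hkillp12' := hkillp12 X hX hΘX hXΘ hXc
    have hkillp14' := hkillp14 X hX hΘX hXΘ hXc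
    have hkillp16' := hkillp16 X hX hΘX hXΘ hXc
    have hrk := hS X hX hΘX hXΘ
    have hd := hdich X hX hΘX hXΘ hXc
    rw [hs] at hrk
    generalize Module.finrank ℂ ↥(Submodule.map X Um) = jj at *
    have hjle : jj ≤ 16 := by omega
    interval_cases jj
    · exact Or.inl ⟨by omega, rfl⟩
    · exact (hkillm1' rfl).elim
    · exfalso; omega
    · exact (hkillm3' rfl).elim
    · exfalso; omega
    · exact (hkillm5' rfl).elim
    · exfalso; omega
    · exact (hkillm7' rfl).elim
    · exfalso; omega
    · exfalso; omega
    · exfalso; omega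
    · exact (hkillm11' rfl).elim
    · exfalso; omega
    · exact (hkillm13' rfl).elim
    · exfalso; omega
    · exfalso; omega
    · exact Or.inr (⟨by omega, rfl⟩)
  obtain ⟨⟨p, hp⟩, hp0⟩ := Module.finrank_pos_iff_exists_ne_zero.1 (show 0 < Module.finrank ℂ PU by omega)
  obtain ⟨⟨q, hq⟩, hq0⟩ := Module.finrank_pos_iff_exists_ne_zero.1 (show 0 < Module.finrank ℂ QU by omega)
  obtain ⟨X₀, hX₀, hΘX₀, hX₀Θ, hX₀c, c₀, hιc₀, -, hX₀c0⟩ :=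
    UnitaryLeviFull.exists_raise_commute_apply_ne_zero hbr hirr hΘ hΘΘ hQ hιmem hιι hιΘ hUm hUp
      ⟨p, fun h => hp0 (Subtype.ext h), ((hPU p).1 hp).1, ((hPU p).1 hp).2⟩
      ⟨q, fun h => hq0 (Subtype.ext h), ((hQU q).1 hq).1, ((hQU q).1 hq).2⟩
  have hX₀i : Module.finrank ℂ (Up.map X₀) ≠ 0 := fun h0 => by
    have hmem : X₀ c₀ ∈ Up.map X₀ := Submodule.mem_map_of_mem ((hUp c₀).2 hιc₀)
    rw [Submodule.finrank_eq_zero.1 h0, Submodule.mem_bot] at hmem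
    exact hX₀c0 hmem
  have hp0 := hprof X₀ hX₀ hΘX₀ hX₀Θ hX₀c
  omega

/-- `(35 | 54)`, minimal rank `17`: after the Levi kills every profile has `i = 0` (profiles [(0, 0)]), against the non-vanishing lemma. [cite: Ribet1983, Thm. 3] [cite: Gordon1997, Thm. 6.3 (3)]
[cite: Deligne1982HodgeCycles, I §3 Prop. 3.4, 3.6] [cite: GoodmanWallachGTM255, §4.1.1] -/
theorem UnitaryThirtyFiveFiftyFour.no_minRank_17 [FiniteDimensional ℂ W] {𝔊 : Submodule ℂ (Module.End ℂ W)}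
    (hbr : ∀ Y ∈ 𝔊, ∀ Z ∈ 𝔊, Y * Z - Z * Y ∈ 𝔊)
    (hirr : ∀ U : Submodule ℂ W, (∀ A ∈ 𝔊, ∀ u ∈ U, A u ∈ U) → U = ⊥ ∨ U = ⊤)
    {Θ : Module.End ℂ W} (hΘ : Θ ∈ 𝔊) (hΘΘ : Θ * Θ = 1)
    {P Q : Submodule ℂ W} (hP : ∀ x, x ∈ P ↔ Θ x = x) (hQ : ∀ x, x ∈ Q ↔ Θ x = -x)
    (hP35 : Module.finrank ℂ P = 35) (hQ54 : Module.finrank ℂ Q = 54)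
    {s : W → W → ℂ} (hadd : ∀ x y z, s (x + y) z = s x z + s y z)
    (hsmul : ∀ (c : ℂ) (x y : W), s (c • x) y = c * s x y) (hsymm : ∀ x y, s y x = starRingEnd ℂ (s x y))
    (hPQ : ∀ p ∈ P, ∀ q ∈ Q, s p q = 0) (hdefP : ∀ p ∈ P, s p p = 0 → p = 0) (hdefQ : ∀ q ∈ Q, s q q = 0 → q = 0)
    (hadj : ∀ X ∈ 𝔊, ∃ Y ∈ 𝔊, ∀ x y, s (X x) y = s x (Y y))
    (hS : ∀ B' ∈ 𝔊, Θ * B' = B' → B' * Θ = -B' →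
      Module.finrank ℂ (LinearMap.range B') = 0 ∨ Module.finrank ℂ (LinearMap.range B') = 17 ∨ Module.finrank ℂ (LinearMap.range B') = 18 ∨ Module.finrank ℂ (LinearMap.range B') = 19 ∨ Module.finrank ℂ (LinearMap.range B') = 20 ∨ Module.finrank ℂ (LinearMap.range B') = 21 ∨ Module.finrank ℂ (LinearMap.range B') = 22 ∨ Module.finrank ℂ (LinearMap.range B') = 23 ∨ Module.finrank ℂ (LinearMap.range B') = 24 ∨ Module.finrank ℂ (LinearMap.range B') = 25 ∨ Module.finrank ℂ (LinearMap.range B') = 26 ∨ Module.finrank ℂ (LinearMap.range B') = 27 ∨ Module.finrank ℂ (LinearMap.range B') = 28 ∨ Module.finrank ℂ (LinearMap.range B') = 29 ∨ Module.finrank ℂ (LinearMap.range B') = 30 ∨ Module.finrank ℂ (LinearMap.range B') = 31 ∨ Module.finrank ℂ (LinearMap.range B') = 32 ∨ Module.finrank ℂ (LinearMap.range B') = 33 ∨ Module.finrank ℂ (LinearMap.range B') = 34 ∨ Module.finrank ℂ (LinearMap.range B') = 35)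
    {B : Module.End ℂ W} (hB : B ∈ 𝔊) (hΘB : Θ * B = B) (hBΘ : B * Θ = -B)
    (hr : Module.finrank ℂ (LinearMap.range B) = 17) : False := by
  classical
  have hsU : ∀ U : Submodule ℂ W, ∀ x y z : U, s ((x + y : U) : W) z = s (x : W) z + s (y : W) z :=
    fun U x y z => by simp only [Submodule.coe_add, hadd]
  have hsmU : ∀ U : Submodule ℂ W, ∀ (c : ℂ) (x y : U), s ((c • x : U) : W) y = c * s (x : W) y :=
    fun U c x y => by simp only [Submodule.coe_smul, hsmul]
  have hno1 : ∀ B' ∈ 𝔊, Θ * B' = B' → B' * Θ = -B' → Module.finrank ℂ (LinearMap.range B') ≠ 1 := by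
    intro B' hB' hΘB' hB'Θ h1
    rcases hS B' hB' hΘB' hB'Θ with h | h | h | h | h | h | h | h | h | h | h | h | h | h | h | h | h | h | h | h <;> omega
  have hmin : ∀ Y ∈ 𝔊, Θ * Y = Y → Y * Θ = -Y → Y ≠ 0 → 17 ≤ Module.finrank ℂ (LinearMap.range Y) := by
    intro Y hY hΘY hYΘ hY0
    have h0 : Module.finrank ℂ (LinearMap.range Y) ≠ 0 := fun h =>
      hY0 (LinearMap.range_eq_bot.1 (Submodule.finrank_eq_zero.1 h))
    rcases hS Y hY hΘY hYΘ with h | h | h | h | h | h | h | h | h | h | h | h | h | h | h | h | h | h | h | h <;> omega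
  have hmin' : ∀ Z ∈ 𝔊, Θ * Z = Z → Z * Θ = -Z → Z ≠ 0 → Module.finrank ℂ (LinearMap.range B) ≤ Module.finrank ℂ (LinearMap.range Z) := by
    rw [hr]; exact hmin
  obtain ⟨ι, Um, Up, PU, QU, Lm, ιm, Pm, Qm, Lp, ιp, Pp, Qp, hιmem, hιι, hιΘ, hιs, hUm, hUp, hfinUm, hfinUp,
    hPM, hQM, hPU, hQU, hrangeP, hPUP, hQUQ, hfinQM, hfinPU, hfinQU, hLm, hLp,
    hιmapply, hPmmem, hQmmem, hbrLm, hirrLm, hιmmem, hιmιm, hPm, hQm, hfinPm, hfinQm, hPmQm, hdefPm, hdefQm, hadjLm,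
    hιpapply, hPpmem, hQpmem, hbrLp, hirrLp, hιpmem, hιpιp, hPp, hQp, hfinPp, hfinQp, hPpQp, hdefPp, hdefQp, hadjLp,
    hsplit⟩ :=
    UnitaryLeviSetup.exists_levi_pair hbr hirr hΘ hΘΘ hP hQ hadd hsymm hPQ hdefP hdefQ hadj hB hΘB hBΘ
  have hdich : ∀ X ∈ 𝔊, Θ * X = X → X * Θ = -X → X * ι = ι * X →
      Module.finrank ℂ (Up.map X) + Module.finrank ℂ (Um.map X) ≤ Module.finrank ℂ (LinearMap.range B) ∨
        (17 ≤ Module.finrank ℂ (Up.map X) ∧ 17 ≤ Module.finrank ℂ (Um.map X)) := fun X hX hΘX hXΘ hXc =>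
    UnitaryLeviSetup.profile_dichotomy hbr hΘΘ hP hQ hadd hsymm hPQ hdefP hdefQ hadj hmin hB hΘB hBΘ hιι hιΘ hιs hUm hUp
      hPM hQM hQU hfinQU hrangeP hX hΘX hXΘ hXc
  have hfinQU' := hfinQU
  rw [hr] at hfinQM hfinPU hfinQU hfinPm hfinQm hfinPp hfinQp hsplit hdich
  rw [hQ54] at hfinQM hfinQm hfinUm
  rw [hP35] at hfinPU hfinPp hfinUp
  have hcm : ∀ Z : Module.End ℂ W, Z * ι = ι * Z → ∀ x ∈ Um, Z x ∈ Um := fun Z hZ x hx =>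
    (hUm _).2 (by rw [← Module.End.mul_apply, ← hZ, Module.End.mul_apply, (hUm x).1 hx, map_neg])
  have hcp : ∀ Z : Module.End ℂ W, Z * ι = ι * Z → ∀ x ∈ Up, Z x ∈ Up := fun Z hZ x hx =>
    (hUp _).2 (by rw [← Module.End.mul_apply, ← hZ, Module.End.mul_apply, (hUp x).1 hx])
  have hfullm_of : Lm = ⊤ → False := fun h =>
    UnitaryLeviSetup.false_of_full_larger hbr hΘΘ hno1 hιι hιΘ hUm hUp (by omega) (by omega) hPM hQM (by omega)
      (by omega) hLm h
  have hkillm1 : ∀ X ∈ 𝔊, Θ * X = X → X * Θ = -X → X * ι = ι * X → Module.finrank ℂ (Um.map X) ≠ 1 := by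
    intro X hX hΘX hXΘ hXc h1
    obtain ⟨hxmem, hιmx, hxιm, hxrk⟩ := UnitaryLeviSetup.restrict_mem hcm hLm hιmapply X hX hΘX hXΘ hXc
    rw [h1] at hxrk
    exact hfullm_of (UnitaryRankOneRaise.eq_top_of_rankOne_raise hbrLm hirrLm hιmmem hιmιm hPm hQm
      (s := fun v w : Um => s (v : W) w) (hsU Um) (fun v w => hsymm v w) hPmQm hdefPm hdefQm hadjLm hxmem hιmx hxιm
      hxrk (by omega) (by omega) (by omega))
  have hkillm2 : ∀ X ∈ 𝔊, Θ * X = X → X * Θ = -X → X * ι = ι * X → Module.finrank ℂ (Um.map X) ≠ 2 := by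
    intro X hX hΘX hXΘ hXc h2
    obtain ⟨hxmem, hιmx, hxιm, hxrk⟩ := UnitaryLeviSetup.restrict_mem hcm hLm hιmapply X hX hΘX hXΘ hXc
    rw [h2] at hxrk
    refine hfullm_of (UnitaryDoubleLevi.eq_top_of_raise_of_core hbrLm hirrLm hιmmem hιmιm hPm hQm
      (s := fun v w : Um => s (v : W) w) (hsU Um) (fun v w => hsymm v w) hPmQm hdefPm hdefQm hadjLm hxmem hιmx hxιm
      (by rw [hxrk]; omega) (by omega) (by omega)
      fun U' 𝔩' ι' P' Q' hbr𝔩' hirr𝔩' hι' hι'ι' hP' hQ' hfinP' hfinQ' hP'Q' hdefP' hdefQ' hadj𝔩' => ?_)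
    rw [hxrk] at hfinP' hfinQ'
    exact UnitaryTwoOdd.eq_top hbr𝔩' hirr𝔩' hι' hι'ι' hP' hQ' hfinP' ⟨17, by omega⟩ (s := fun x y : U' => s ((x : Um) : W) y) (fun x y z => by simp only [Submodule.coe_add, hadd]) (fun x y => hsymm _ _) hP'Q' hdefP' hdefQ' hadj𝔩'
  have hkillm3 : ∀ X ∈ 𝔊, Θ * X = X → X * Θ = -X → X * ι = ι * X → Module.finrank ℂ (Um.map X) ≠ 3 := by
    intro X hX hΘX hXΘ hXc h3
    obtain ⟨hxmem, hιmx, hxιm, hxrk⟩ := UnitaryLeviSetup.restrict_mem hcm hLm hιmapply X hX hΘX hXΘ hXc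
    rw [h3] at hxrk
    refine hfullm_of (UnitaryDoubleLevi.eq_top_of_raise_of_core hbrLm hirrLm hιmmem hιmιm hPm hQm
      (s := fun v w : Um => s (v : W) w) (hsU Um) (fun v w => hsymm v w) hPmQm hdefPm hdefQm hadjLm hxmem hιmx hxιm
      (by rw [hxrk]; omega) (by omega) (by omega)
      fun U' 𝔩' ι' P' Q' hbr𝔩' hirr𝔩' hι' hι'ι' hP' hQ' hfinP' hfinQ' hP'Q' hdefP' hdefQ' hadj𝔩' => ?_)
    rw [hxrk] at hfinP' hfinQ'
    exact UnitaryThreeCoprime.eq_top hbr𝔩' hirr𝔩' hι' hι'ι' hP' hQ' hfinP' (by omega) (s := fun x y : U' => s ((x : Um) : W) y) (fun x y z => by simp only [Submodule.coe_add, hadd]) (fun x y => hsymm _ _) hP'Q' hdefP' hdefQ' hadj𝔩'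
  have hkillm4 : ∀ X ∈ 𝔊, Θ * X = X → X * Θ = -X → X * ι = ι * X → Module.finrank ℂ (Um.map X) ≠ 4 := by
    intro X hX hΘX hXΘ hXc h4
    obtain ⟨hxmem, hιmx, hxιm, hxrk⟩ := UnitaryLeviSetup.restrict_mem hcm hLm hιmapply X hX hΘX hXΘ hXc
    rw [h4] at hxrk
    refine hfullm_of (UnitaryDoubleLevi.eq_top_of_raise_of_core hbrLm hirrLm hιmmem hιmιm hPm hQm
      (s := fun v w : Um => s (v : W) w) (hsU Um) (fun v w => hsymm v w) hPmQm hdefPm hdefQm hadjLm hxmem hιmx hxιm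
      (by rw [hxrk]; omega) (by omega) (by omega)
      fun U' 𝔩' ι' P' Q' hbr𝔩' hirr𝔩' hι' hι'ι' hP' hQ' hfinP' hfinQ' hP'Q' hdefP' hdefQ' hadj𝔩' => ?_)
    rw [hxrk] at hfinP' hfinQ'
    exact UnitaryFourOdd.eq_top hbr𝔩' hirr𝔩' hι' hι'ι' hP' hQ' hfinP' ⟨16, by omega⟩ (s := fun x y : U' => s ((x : Um) : W) y) (fun x y z => by simp only [Submodule.coe_add, hadd]) (fun x y => hsymm _ _) hP'Q' hdefP' hdefQ' hadj𝔩'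
  have hkillm5 : ∀ X ∈ 𝔊, Θ * X = X → X * Θ = -X → X * ι = ι * X → Module.finrank ℂ (Um.map X) ≠ 5 := by
    intro X hX hΘX hXΘ hXc h5
    obtain ⟨hxmem, hιmx, hxιm, hxrk⟩ := UnitaryLeviSetup.restrict_mem hcm hLm hιmapply X hX hΘX hXΘ hXc
    rw [h5] at hxrk
    refine hfullm_of (UnitaryDoubleLevi.eq_top_of_raise_of_core hbrLm hirrLm hιmmem hιmιm hPm hQm
      (s := fun v w : Um => s (v : W) w) (hsU Um) (fun v w => hsymm v w) hPmQm hdefPm hdefQm hadjLm hxmem hιmx hxιm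
      (by rw [hxrk]; omega) (by omega) (by omega)
      fun U' 𝔩' ι' P' Q' hbr𝔩' hirr𝔩' hι' hι'ι' hP' hQ' hfinP' hfinQ' hP'Q' hdefP' hdefQ' hadj𝔩' => ?_)
    rw [hxrk] at hfinP' hfinQ'
    exact UnitaryFive.eq_top_of_smul hbr𝔩' hirr𝔩' hι' hι'ι' hP' hQ' hfinP' (by omega) (s := fun x y : U' => s ((x : Um) : W) y) (fun x y z => by simp only [Submodule.coe_add, hadd]) (fun c x y => by simp only [Submodule.coe_smul, hsmul]) (fun x y => hsymm _ _) hP'Q' hdefP' hdefQ' hadj𝔩'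
  have hkillm6 : ∀ X ∈ 𝔊, Θ * X = X → X * Θ = -X → X * ι = ι * X → Module.finrank ℂ (Um.map X) ≠ 6 := by
    intro X hX hΘX hXΘ hXc h6
    obtain ⟨hxmem, hιmx, hxιm, hxrk⟩ := UnitaryLeviSetup.restrict_mem hcm hLm hιmapply X hX hΘX hXΘ hXc
    rw [h6] at hxrk
    refine hfullm_of (UnitaryDoubleLevi.eq_top_of_raise_of_core hbrLm hirrLm hιmmem hιmιm hPm hQm
      (s := fun v w : Um => s (v : W) w) (hsU Um) (fun v w => hsymm v w) hPmQm hdefPm hdefQm hadjLm hxmem hιmx hxιm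
      (by rw [hxrk]; omega) (by omega) (by omega)
      fun U' 𝔩' ι' P' Q' hbr𝔩' hirr𝔩' hι' hι'ι' hP' hQ' hfinP' hfinQ' hP'Q' hdefP' hdefQ' hadj𝔩' => ?_)
    rw [hxrk] at hfinP' hfinQ'
    exact UnitarySix.eq_top_of_smul hbr𝔩' hirr𝔩' hι' hι'ι' hP' hQ' hfinP' ⟨15, by omega⟩ (by omega) (s := fun x y : U' => s ((x : Um) : W) y) (fun x y z => by simp only [Submodule.coe_add, hadd]) (fun c x y => by simp only [Submodule.coe_smul, hsmul]) (fun x y => hsymm _ _) hP'Q' hdefP' hdefQ' hadj𝔩'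
  have hkillm7 : ∀ X ∈ 𝔊, Θ * X = X → X * Θ = -X → X * ι = ι * X → Module.finrank ℂ (Um.map X) ≠ 7 := by
    intro X hX hΘX hXΘ hXc h7
    obtain ⟨hxmem, hιmx, hxιm, hxrk⟩ := UnitaryLeviSetup.restrict_mem hcm hLm hιmapply X hX hΘX hXΘ hXc
    rw [h7] at hxrk
    refine hfullm_of (UnitaryDoubleLevi.eq_top_of_raise_of_core hbrLm hirrLm hιmmem hιmιm hPm hQm
      (s := fun v w : Um => s (v : W) w) (hsU Um) (fun v w => hsymm v w) hPmQm hdefPm hdefQm hadjLm hxmem hιmx hxιm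
      (by rw [hxrk]; omega) (by omega) (by omega)
      fun U' 𝔩' ι' P' Q' hbr𝔩' hirr𝔩' hι' hι'ι' hP' hQ' hfinP' hfinQ' hP'Q' hdefP' hdefQ' hadj𝔩' => ?_)
    rw [hxrk] at hfinP' hfinQ'
    exact UnitarySeven.eq_top_of_smul hbr𝔩' hirr𝔩' hι' hι'ι' hP' hQ' hfinP' (by omega) (s := fun x y : U' => s ((x : Um) : W) y) (fun x y z => by simp only [Submodule.coe_add, hadd]) (fun c x y => by simp only [Submodule.coe_smul, hsmul]) (fun x y => hsymm _ _) hP'Q' hdefP' hdefQ' hadj𝔩'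
  have hkillm8 : ∀ X ∈ 𝔊, Θ * X = X → X * Θ = -X → X * ι = ι * X → Module.finrank ℂ (Um.map X) ≠ 8 := by
    intro X hX hΘX hXΘ hXc h8
    obtain ⟨hxmem, hιmx, hxιm, hxrk⟩ := UnitaryLeviSetup.restrict_mem hcm hLm hιmapply X hX hΘX hXΘ hXc
    rw [h8] at hxrk
    refine hfullm_of (UnitaryDoubleLevi.eq_top_of_raise_of_core hbrLm hirrLm hιmmem hιmιm hPm hQm
      (s := fun v w : Um => s (v : W) w) (hsU Um) (fun v w => hsymm v w) hPmQm hdefPm hdefQm hadjLm hxmem hιmx hxιm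
      (by rw [hxrk]; omega) (by omega) (by omega)
      fun U' 𝔩' ι' P' Q' hbr𝔩' hirr𝔩' hι' hι'ι' hP' hQ' hfinP' hfinQ' hP'Q' hdefP' hdefQ' hadj𝔩' => ?_)
    rw [hxrk] at hfinP' hfinQ'
    exact UnitaryEight.eq_top_of_smul_twentynine hbr𝔩' hirr𝔩' hι' hι'ι' hP' hQ' hfinP' (by omega) (s := fun x y : U' => s ((x : Um) : W) y) (fun x y z => by simp only [Submodule.coe_add, hadd]) (fun c x y => by simp only [Submodule.coe_smul, hsmul]) (fun x y => hsymm _ _) hP'Q' hdefP' hdefQ' hadj𝔩'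
  have hkillm9 : ∀ X ∈ 𝔊, Θ * X = X → X * Θ = -X → X * ι = ι * X → Module.finrank ℂ (Um.map X) ≠ 9 := by
    intro X hX hΘX hXΘ hXc h9
    obtain ⟨hxmem, hιmx, hxιm, hxrk⟩ := UnitaryLeviSetup.restrict_mem hcm hLm hιmapply X hX hΘX hXΘ hXc
    rw [h9] at hxrk
    refine hfullm_of (UnitaryDoubleLevi.eq_top_of_raise_of_core hbrLm hirrLm hιmmem hιmιm hPm hQm
      (s := fun v w : Um => s (v : W) w) (hsU Um) (fun v w => hsymm v w) hPmQm hdefPm hdefQm hadjLm hxmem hιmx hxιm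
      (by rw [hxrk]; omega) (by omega) (by omega)
      fun U' 𝔩' ι' P' Q' hbr𝔩' hirr𝔩' hι' hι'ι' hP' hQ' hfinP' hfinQ' hP'Q' hdefP' hdefQ' hadj𝔩' => ?_)
    rw [hxrk] at hfinP' hfinQ'
    exact UnitaryNineTwentyEight.eq_top_of_smul hbr𝔩' hirr𝔩' hι' hι'ι' hP' hQ' hfinP' (by omega) (s := fun x y : U' => s ((x : Um) : W) y) (fun x y z => by simp only [Submodule.coe_add, hadd]) (fun c x y => by simp only [Submodule.coe_smul, hsmul]) (fun x y => hsymm _ _) hP'Q' hdefP' hdefQ' hadj𝔩'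
  have hkillm10 : ∀ X ∈ 𝔊, Θ * X = X → X * Θ = -X → X * ι = ι * X → Module.finrank ℂ (Um.map X) ≠ 10 := by
    intro X hX hΘX hXΘ hXc h10
    obtain ⟨hxmem, hιmx, hxιm, hxrk⟩ := UnitaryLeviSetup.restrict_mem hcm hLm hιmapply X hX hΘX hXΘ hXc
    rw [h10] at hxrk
    refine hfullm_of (UnitaryDoubleLevi.eq_top_of_raise_of_core hbrLm hirrLm hιmmem hιmιm hPm hQm
      (s := fun v w : Um => s (v : W) w) (hsU Um) (fun v w => hsymm v w) hPmQm hdefPm hdefQm hadjLm hxmem hιmx hxιm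
      (by rw [hxrk]; omega) (by omega) (by omega)
      fun U' 𝔩' ι' P' Q' hbr𝔩' hirr𝔩' hι' hι'ι' hP' hQ' hfinP' hfinQ' hP'Q' hdefP' hdefQ' hadj𝔩' => ?_)
    rw [hxrk] at hfinP' hfinQ'
    exact UnitaryTenTwentySeven.eq_top_of_smul hbr𝔩' hirr𝔩' hι' hι'ι' hP' hQ' hfinP' (by omega) (s := fun x y : U' => s ((x : Um) : W) y) (fun x y z => by simp only [Submodule.coe_add, hadd]) (fun c x y => by simp only [Submodule.coe_smul, hsmul]) (fun x y => hsymm _ _) hP'Q' hdefP' hdefQ' hadj𝔩'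
  have hkillm11 : ∀ X ∈ 𝔊, Θ * X = X → X * Θ = -X → X * ι = ι * X → Module.finrank ℂ (Um.map X) ≠ 11 := by
    intro X hX hΘX hXΘ hXc h11
    obtain ⟨hxmem, hιmx, hxιm, hxrk⟩ := UnitaryLeviSetup.restrict_mem hcm hLm hιmapply X hX hΘX hXΘ hXc
    rw [h11] at hxrk
    refine hfullm_of (UnitaryDoubleLevi.eq_top_of_raise_of_core hbrLm hirrLm hιmmem hιmιm hPm hQm
      (s := fun v w : Um => s (v : W) w) (hsU Um) (fun v w => hsymm v w) hPmQm hdefPm hdefQm hadjLm hxmem hιmx hxιm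
      (by rw [hxrk]; omega) (by omega) (by omega)
      fun U' 𝔩' ι' P' Q' hbr𝔩' hirr𝔩' hι' hι'ι' hP' hQ' hfinP' hfinQ' hP'Q' hdefP' hdefQ' hadj𝔩' => ?_)
    rw [hxrk] at hfinP' hfinQ'
    exact UnitaryEleven.eq_top_of_smul hbr𝔩' hirr𝔩' hι' hι'ι' hP' hQ' hfinP' (by omega) (s := fun x y : U' => s ((x : Um) : W) y) (fun x y z => by simp only [Submodule.coe_add, hadd]) (fun c x y => by simp only [Submodule.coe_smul, hsmul]) (fun x y => hsymm _ _) hP'Q' hdefP' hdefQ' hadj𝔩'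
  have hkillm12 : ∀ X ∈ 𝔊, Θ * X = X → X * Θ = -X → X * ι = ι * X → Module.finrank ℂ (Um.map X) ≠ 12 := by
    intro X hX hΘX hXΘ hXc h12
    obtain ⟨hxmem, hιmx, hxιm, hxrk⟩ := UnitaryLeviSetup.restrict_mem hcm hLm hιmapply X hX hΘX hXΘ hXc
    rw [h12] at hxrk
    refine hfullm_of (UnitaryDoubleLevi.eq_top_of_raise_of_core hbrLm hirrLm hιmmem hιmιm hPm hQm
      (s := fun v w : Um => s (v : W) w) (hsU Um) (fun v w => hsymm v w) hPmQm hdefPm hdefQm hadjLm hxmem hιmx hxιm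
      (by rw [hxrk]; omega) (by omega) (by omega)
      fun U' 𝔩' ι' P' Q' hbr𝔩' hirr𝔩' hι' hι'ι' hP' hQ' hfinP' hfinQ' hP'Q' hdefP' hdefQ' hadj𝔩' => ?_)
    rw [hxrk] at hfinP' hfinQ'
    exact UnitaryTwelveTwentyFive.eq_top_of_smul hbr𝔩' hirr𝔩' hι' hι'ι' hP' hQ' hfinP' (by omega) (s := fun x y : U' => s ((x : Um) : W) y) (fun x y z => by simp only [Submodule.coe_add, hadd]) (fun c x y => by simp only [Submodule.coe_smul, hsmul]) (fun x y => hsymm _ _) hP'Q' hdefP' hdefQ' hadj𝔩'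
  have hkillm13 : ∀ X ∈ 𝔊, Θ * X = X → X * Θ = -X → X * ι = ι * X → Module.finrank ℂ (Um.map X) ≠ 13 := by
    intro X hX hΘX hXΘ hXc h13
    obtain ⟨hxmem, hιmx, hxιm, hxrk⟩ := UnitaryLeviSetup.restrict_mem hcm hLm hιmapply X hX hΘX hXΘ hXc
    rw [h13] at hxrk
    refine hfullm_of (UnitaryDoubleLevi.eq_top_of_raise_of_core hbrLm hirrLm hιmmem hιmιm hPm hQm
      (s := fun v w : Um => s (v : W) w) (hsU Um) (fun v w => hsymm v w) hPmQm hdefPm hdefQm hadjLm hxmem hιmx hxιm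
      (by rw [hxrk]; omega) (by omega) (by omega)
      fun U' 𝔩' ι' P' Q' hbr𝔩' hirr𝔩' hι' hι'ι' hP' hQ' hfinP' hfinQ' hP'Q' hdefP' hdefQ' hadj𝔩' => ?_)
    rw [hxrk] at hfinP' hfinQ'
    exact UnitaryThirteen.eq_top_of_smul hbr𝔩' hirr𝔩' hι' hι'ι' hP' hQ' hfinP' (by omega) (s := fun x y : U' => s ((x : Um) : W) y) (fun x y z => by simp only [Submodule.coe_add, hadd]) (fun c x y => by simp only [Submodule.coe_smul, hsmul]) (fun x y => hsymm _ _) hP'Q' hdefP' hdefQ' hadj𝔩'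
  have hkillm14 : ∀ X ∈ 𝔊, Θ * X = X → X * Θ = -X → X * ι = ι * X → Module.finrank ℂ (Um.map X) ≠ 14 := by
    intro X hX hΘX hXΘ hXc h14
    obtain ⟨hxmem, hιmx, hxιm, hxrk⟩ := UnitaryLeviSetup.restrict_mem hcm hLm hιmapply X hX hΘX hXΘ hXc
    rw [h14] at hxrk
    refine hfullm_of (UnitaryDoubleLevi.eq_top_of_raise_of_core hbrLm hirrLm hιmmem hιmιm hPm hQm
      (s := fun v w : Um => s (v : W) w) (hsU Um) (fun v w => hsymm v w) hPmQm hdefPm hdefQm hadjLm hxmem hιmx hxιm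
      (by rw [hxrk]; omega) (by omega) (by omega)
      fun U' 𝔩' ι' P' Q' hbr𝔩' hirr𝔩' hι' hι'ι' hP' hQ' hfinP' hfinQ' hP'Q' hdefP' hdefQ' hadj𝔩' => ?_)
    rw [hxrk] at hfinP' hfinQ'
    exact UnitaryFourteenTwentyThree.eq_top_of_smul hbr𝔩' hirr𝔩' hι' hι'ι' hP' hQ' hfinP' (by omega) (s := fun x y : U' => s ((x : Um) : W) y) (fun x y z => by simp only [Submodule.coe_add, hadd]) (fun c x y => by simp only [Submodule.coe_smul, hsmul]) (fun x y => hsymm _ _) hP'Q' hdefP' hdefQ' hadj𝔩'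
  have hkillm15 : ∀ X ∈ 𝔊, Θ * X = X → X * Θ = -X → X * ι = ι * X → Module.finrank ℂ (Um.map X) ≠ 15 := by
    intro X hX hΘX hXΘ hXc h15
    obtain ⟨hxmem, hιmx, hxιm, hxrk⟩ := UnitaryLeviSetup.restrict_mem hcm hLm hιmapply X hX hΘX hXΘ hXc
    rw [h15] at hxrk
    refine hfullm_of (UnitaryDoubleLevi.eq_top_of_raise_of_core hbrLm hirrLm hιmmem hιmιm hPm hQm
      (s := fun v w : Um => s (v : W) w) (hsU Um) (fun v w => hsymm v w) hPmQm hdefPm hdefQm hadjLm hxmem hιmx hxιm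
      (by rw [hxrk]; omega) (by omega) (by omega)
      fun U' 𝔩' ι' P' Q' hbr𝔩' hirr𝔩' hι' hι'ι' hP' hQ' hfinP' hfinQ' hP'Q' hdefP' hdefQ' hadj𝔩' => ?_)
    rw [hxrk] at hfinP' hfinQ'
    exact UnitaryFifteenTwentyTwo.eq_top_of_smul hbr𝔩' hirr𝔩' hι' hι'ι' hP' hQ' hfinP' (by omega) (s := fun x y : U' => s ((x : Um) : W) y) (fun x y z => by simp only [Submodule.coe_add, hadd]) (fun c x y => by simp only [Submodule.coe_smul, hsmul]) (fun x y => hsymm _ _) hP'Q' hdefP' hdefQ' hadj𝔩'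
  have hkillm16 : ∀ X ∈ 𝔊, Θ * X = X → X * Θ = -X → X * ι = ι * X → Module.finrank ℂ (Um.map X) ≠ 16 := by
    intro X hX hΘX hXΘ hXc h16
    obtain ⟨hxmem, hιmx, hxιm, hxrk⟩ := UnitaryLeviSetup.restrict_mem hcm hLm hιmapply X hX hΘX hXΘ hXc
    rw [h16] at hxrk
    refine hfullm_of (UnitaryDoubleLevi.eq_top_of_raise_of_core hbrLm hirrLm hιmmem hιmιm hPm hQm
      (s := fun v w : Um => s (v : W) w) (hsU Um) (fun v w => hsymm v w) hPmQm hdefPm hdefQm hadjLm hxmem hιmx hxιm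
      (by rw [hxrk]; omega) (by omega) (by omega)
      fun U' 𝔩' ι' P' Q' hbr𝔩' hirr𝔩' hι' hι'ι' hP' hQ' hfinP' hfinQ' hP'Q' hdefP' hdefQ' hadj𝔩' => ?_)
    rw [hxrk] at hfinP' hfinQ'
    exact UnitarySixteenTwentyOne.eq_top_of_smul hbr𝔩' hirr𝔩' hι' hι'ι' hP' hQ' hfinP' (by omega) (s := fun x y : U' => s ((x : Um) : W) y) (fun x y z => by simp only [Submodule.coe_add, hadd]) (fun c x y => by simp only [Submodule.coe_smul, hsmul]) (fun x y => hsymm _ _) hP'Q' hdefP' hdefQ' hadj𝔩'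
  have hkillm17 : ∀ X ∈ 𝔊, Θ * X = X → X * Θ = -X → X * ι = ι * X → Module.finrank ℂ (Um.map X) ≠ 17 := by
    intro X hX hΘX hXΘ hXc h17
    obtain ⟨hxmem, hιmx, hxιm, hxrk⟩ := UnitaryLeviSetup.restrict_mem hcm hLm hιmapply X hX hΘX hXΘ hXc
    rw [h17] at hxrk
    refine hfullm_of (UnitaryDoubleLevi.eq_top_of_raise_of_core hbrLm hirrLm hιmmem hιmιm hPm hQm
      (s := fun v w : Um => s (v : W) w) (hsU Um) (fun v w => hsymm v w) hPmQm hdefPm hdefQm hadjLm hxmem hιmx hxιm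
      (by rw [hxrk]; omega) (by omega) (by omega)
      fun U' 𝔩' ι' P' Q' hbr𝔩' hirr𝔩' hι' hι'ι' hP' hQ' hfinP' hfinQ' hP'Q' hdefP' hdefQ' hadj𝔩' => ?_)
    rw [hxrk] at hfinP' hfinQ'
    exact UnitarySeventeenTwenty.eq_top_of_smul hbr𝔩' hirr𝔩' hι' hι'ι' hP' hQ' hfinP' (by omega) (s := fun x y : U' => s ((x : Um) : W) y) (fun x y z => by simp only [Submodule.coe_add, hadd]) (fun c x y => by simp only [Submodule.coe_smul, hsmul]) (fun x y => hsymm _ _) hP'Q' hdefP' hdefQ' hadj𝔩'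
  have hfullp_of : Lp = ⊤ → False := by
    intro hLptop
    obtain ⟨T1, hιT1, hT1ι, hT1r⟩ := UnitaryRaisingSpace.exists_raise_finrank_range_eq hιpιp hPp hQp (k := 1)
      (by omega) (by omega)
    obtain ⟨X1, hX1, hΘX1, hX1Θ, hX1c, hX1Up⟩ := UnitaryLeviSetup.exists_lift hbr hΘ hΘΘ hcp hιΘ hLp hιpapply T1
      (by rw [hLptop]; exact Submodule.mem_top) hιT1 hT1ι
    rw [hT1r] at hX1Up
    obtain ⟨hs1, hi1, hi1', hj1, hj1'⟩ := hsplit X1 hΘX1 hX1Θ hX1c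
    have hrk1 := hS X1 hX1 hΘX1 hX1Θ
    have hd1 := hdich X1 hX1 hΘX1 hX1Θ hX1c
    rw [hs1] at hrk1
    rw [hX1Up] at hrk1 hd1
    have hk_hkillm16 := hkillm16 X1 hX1 hΘX1 hX1Θ hX1c
    omega
  have hkillp17 : ∀ X ∈ 𝔊, Θ * X = X → X * Θ = -X → X * ι = ι * X → Module.finrank ℂ (Up.map X) ≠ 17 := by
    intro X hX hΘX hXΘ hXc h17
    obtain ⟨hymem, hιpy, hyιp, hyrk⟩ := UnitaryLeviSetup.restrict_mem hcp hLp hιpapply X hX hΘX hXΘ hXc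
    rw [h17] at hyrk
    refine hfullp_of (UnitaryDoubleLevi.eq_top_of_raise_of_core' hbrLp hirrLp hιpmem hιpιp hPp hQp
      (s := fun v w : Up => s (v : W) w) (hsU Up) (fun v w => hsymm v w) hPpQp hdefPp hdefQp hadjLp hymem hιpy hyιp
      (by rw [hyrk]; omega) (by omega) (by omega)
      fun U' 𝔩' ι' P' Q' hbr𝔩' hirr𝔩' hι' hι'ι' hP' hQ' hfinP' hfinQ' hP'Q' hdefP' hdefQ' hadj𝔩' => ?_)
    rw [hyrk] at hfinP' hfinQ'
    exact UnitaryThreeCoprime.eq_top_of_finrank_eq_one hbr𝔩' hirr𝔩' hι' hι'ι' hP' hQ' (by omega) (by omega)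
  have hprof : ∀ X ∈ 𝔊, Θ * X = X → X * Θ = -X → X * ι = ι * X →
      (Module.finrank ℂ (Up.map X) = 0 ∧ Module.finrank ℂ (Um.map X) = 0) := by
    intro X hX hΘX hXΘ hXc
    obtain ⟨hs, hi, hi', hj, hj'⟩ := hsplit X hΘX hXΘ hXc
    have hkillm1' := hkillm1 X hX hΘX hXΘ hXc
    have hkillm2' := hkillm2 X hX hΘX hXΘ hXc
    have hkillm3' := hkillm3 X hX hΘX hXΘ hXc
    have hkillm4' := hkillm4 X hX hΘX hXΘ hXc
    have hkillm5' := hkillm5 X hX hΘX hXΘ hXc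
    have hkillm6' := hkillm6 X hX hΘX hXΘ hXc
    have hkillm7' := hkillm7 X hX hΘX hXΘ hXc
    have hkillm8' := hkillm8 X hX hΘX hXΘ hXc
    have hkillm9' := hkillm9 X hX hΘX hXΘ hXc
    have hkillm10' := hkillm10 X hX hΘX hXΘ hXc
    have hkillm11' := hkillm11 X hX hΘX hXΘ hXc
    have hkillm12' := hkillm12 X hX hΘX hXΘ hXc
    have hkillm13' := hkillm13 X hX hΘX hXΘ hXc
    have hkillm14' := hkillm14 X hX hΘX hXΘ hXc
    have hkillm15' := hkillm15 X hX hΘX hXΘ hXc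
    have hkillm16' := hkillm16 X hX hΘX hXΘ hXc
    have hkillm17' := hkillm17 X hX hΘX hXΘ hXc
    have hkillp17' := hkillp17 X hX hΘX hXΘ hXc
    have hrk := hS X hX hΘX hXΘ
    have hd := hdich X hX hΘX hXΘ hXc
    rw [hs] at hrk
    generalize Module.finrank ℂ ↥(Submodule.map X Um) = jj at *
    have hjle : jj ≤ 17 := by omega
    interval_cases jj
    · exact ⟨by omega, rfl⟩
    · exact (hkillm1' rfl).elim
    · exact (hkillm2' rfl).elim
    · exact (hkillm3' rfl).elim
    · exact (hkillm4' rfl).elim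
    · exact (hkillm5' rfl).elim
    · exact (hkillm6' rfl).elim
    · exact (hkillm7' rfl).elim
    · exact (hkillm8' rfl).elim
    · exact (hkillm9' rfl).elim
    · exact (hkillm10' rfl).elim
    · exact (hkillm11' rfl).elim
    · exact (hkillm12' rfl).elim
    · exact (hkillm13' rfl).elim
    · exact (hkillm14' rfl).elim
    · exact (hkillm15' rfl).elim
    · exact (hkillm16' rfl).elim
    · exact (hkillm17' rfl).elim
  obtain ⟨⟨p, hp⟩, hp0⟩ := Module.finrank_pos_iff_exists_ne_zero.1 (show 0 < Module.finrank ℂ PU by omega)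
  obtain ⟨⟨q, hq⟩, hq0⟩ := Module.finrank_pos_iff_exists_ne_zero.1 (show 0 < Module.finrank ℂ QU by omega)
  obtain ⟨X₀, hX₀, hΘX₀, hX₀Θ, hX₀c, c₀, hιc₀, -, hX₀c0⟩ :=
    UnitaryLeviFull.exists_raise_commute_apply_ne_zero hbr hirr hΘ hΘΘ hQ hιmem hιι hιΘ hUm hUp
      ⟨p, fun h => hp0 (Subtype.ext h), ((hPU p).1 hp).1, ((hPU p).1 hp).2⟩
      ⟨q, fun h => hq0 (Subtype.ext h), ((hQU q).1 hq).1, ((hQU q).1 hq).2⟩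
  have hX₀i : Module.finrank ℂ (Up.map X₀) ≠ 0 := fun h0 => by
    have hmem : X₀ c₀ ∈ Up.map X₀ := Submodule.mem_map_of_mem ((hUp c₀).2 hιc₀)
    rw [Submodule.finrank_eq_zero.1 h0, Submodule.mem_bot] at hmem
    exact hX₀c0 hmem
  have hp0 := hprof X₀ hX₀ hΘX₀ hX₀Θ hX₀c
  omega


end HodgeStructure

end Literature.AlgebraicGeometry.Motives

end
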